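import Mathlib
import Literature.Analysis.FluidPDE.LerayHopf
import Literature.Analysis.FluidPDE.ClassicalSolution
import Literature.Analysis.FluidPDE.SelfSimilar
import Literature.Analysis.FunctionSpaces.FourierSobolevNorm
import Literature.Analysis.FunctionSpaces.Complexify
import Literature.Analysis.FunctionSpaces.FourierSobolevNormScalingProofs
import Literature.Analysis.FunctionSpaces.HomSobolevInterpolation
import HarnessLib

/-!
# Claim skeleton (D-0090 NS-CLAIMS, C08): Ri, arXiv:2508.19590 v1 — Leray–Hopf solutions from `H^{1/2}` data are globally regular

Typed skeleton of Myong-Hwan Ri, *Global regularity of Leray-Hopf weak solutions to 3D Navier-Stokes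
equations*, arXiv:2508.19590 **v1 of 2025-08-27** (only version; text of record, ASSIGNMENTS v1.1; bib
`Ri2025`; 17 pp.). Locators `l.N` = line of the pinned TeX
`pub/ns-claims/sources/Ri2025/arXiv-2508.19590v1-TeX_PINNED/LogSupercritical_NSreg_final.clean.tex`
(ns-claims-lit-3 LOCATORS.md; no PDF pagination materialised on this hub — print pages WANTED, lit-3).
The generalisation arXiv:2601.15685 (`Ri2026`, all `d ≥ 3`, `ν`-independent constants, Euler application)
repeats the same §2–§3 displays (LOCATORS §4: the averaging bound is verbatim at its l.842–856). UNREFEREED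
CLAIM under adjudication — NOTHING in this file asserts a step of the paper: the paper's statements are
`def … : Prop`; the `theorem`s are kernel-checked relations between them and the composition. Card:
`pub/ns-claims/claims/Ri2025/CARD.md` (typist-9's PREDICTION §4 stands; typed by the replacement typist
ns-claims-typist-7 under the lead's contingency of 2026-08-26T18:50Z; refuter-5, ref-3).

## The claimed statement (Theorem 1.1, l.193–209)

"Let `u` be a Leray-Hopf weak solution to (1.1) with `u₀ ∈ H^{1/2}(ℝ³)`, `div u₀ = 0`. Then
`u ∈ L^∞(0,∞; H^{1/2}(ℝ³)) ∩ L²(0,∞; H^{3/2}(ℝ³))` and the estimate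
(1.2) `‖u(t)‖²_{H^{1/2}} + ν ∫₀ᵗ ‖u(τ)‖²_{H^{3/2}} dτ ≤ 2‖u₀‖²_{H^{1/2}}, ∀ t ∈ (0,∞)` holds. Thus `u` is
globally regular." Setting (1.1) l.103–110: `ℝ³`, `ν > 0`, `f ≡ 0`; Leray–Hopf class with the energy
inequality (EI) l.115–125 — the tree's `IsLerayHopfOn`. Typed as `ClaimedTheorem` (per horizon `T`: every
Leray–Hopf solution on `[0,T)` is classical on `(0,T)` and obeys (1.2) for `t ∈ (0,T)`; all `T > 0`).

Clay delta (reference `Literature.Claims.NS.ClayVariants`): (A)-STRONGER on every axis — `ℝ³`, `f ≡ 0`,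
every `ν > 0`, data `H^{1/2} ⊇` Clay class (4) (summit-side
`Theorems.SoloSalvageRi2025.memFourierSobolev_complexify_of_hasRapidSpatialDecay`), conclusion "every
Leray–Hopf solution is regular with an `L^∞_t H^{1/2}_x` bound" ⇒ (A) by the LANDED summit-side bridge
`StrongHypotheses.navierStokesRegularity_of_lerayHopfSobolevHalfBound` (ESS 2003 + Sobolev; its hypothesis
is `ClaimedLinftyHalfBound` below, which `ClaimedTheorem` implies: `linftyHalfBound_of_claimedTheorem`).
Not a «wrong problem» candidate.

## The proof's architecture (l.240–281, l.660–1033) and the typed steps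

* §2 (l.282–335): the frequency-weighted space `X₁` — dyadic blocks `Δ_j` (sharp annuli
  `2^{j−1} ≤ |ξ| < 2^j`, l.288), the sparse weight `a(j)` (2.2) l.307–315, the norm (2.3) l.316–326
  `‖v‖_{X₁} = ‖{2^{j/2} a(j)⁻¹ ‖Δ_j v‖₂}_j‖_{ℓ²}` — typed CONCRETELY (`a`, `dyadicSq`, `eX1Norm`, on the
  Fourier side via Mathlib's `L²` Fourier transform, as in `Literature.Analysis.FunctionSpaces.FourierSobolevNorm`).
  **Lemma 2.1** (l.336–360) rescaling smallness in `X₁` along `λ = 2^{2^{2^l}}`: `Step_L21i` (part (i)),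
  `Step_L21ii` (part (ii), in the form the close invokes it, l.950–957).
* §3: `b(j)` (3.2) l.526–529, **Lemma 3.1** l.522–540 (`Step_L31`), `S(n)` (4.1) l.629–632, **Lemma 3.2**
  l.635–641 (`Step_L32`), `j₀(k) = ⌈log₂ k⌉ + 1` (4.3) l.707–710. The definitions `a`, `b`, `j₀`, `StepAvg`,
  `StepAvgC` are — TYPING-HYGIENE item 13, lead ruling 18:50Z — the def texts of refuter-5's
  `RiScaffold.lean` VERBATIM (ref-3 pre-check 18:57Z: print-faithful at F1–F4).
* Proof of Thm 1.1, Step 1 (l.660–763): high-frequency energy inequality **(2.15)** l.754–762 —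
  `Step_215` (integrated in time, as consumed at (4.12) l.886; `∃ C₁ > 0` "generic constant independent of
  `ν`").
* Step 2 (l.765–949): re-summation (2.5), (2.25), (2.26) l.769–805; **THE AVERAGING BOUND** l.806–839
  "`Σ_{k=1}^{n} b(j₀(2k)) ≤ 2n + n ≤ 3n` … `Σ_{k=1}^{n} b(j₀(2k+1)) ≤ 3n, ∀ n ≥ n₀`, for some generic number
  `n₀ ∈ ℕ`" — `StepAvg` (verbatim; `StepAvgC` = the «generic constant» reading R#b); then (2.26n) l.841–852,
  (4.13) l.857–868, (4.12) l.886, (4.14) l.909–921, (4.2) l.924, **(4.14n)** l.932–949 — bundled as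
  `Step_414n` ("GIVEN (2.15) with `C₁` and the averaging bound from `n₀`, (4.14n) holds on every regularity
  interval with a constant `C₂`"; `Ineq414n`).
* The RESCALING CLOSE (l.950–1027): `ε = ν/(2C₂)`, Lemma 2.1(ii) ⇒ (4.16); `(u)_λ(τ,x) = λu(λ²τ,λx)` (4.19)
  = the tree's `nsRescale`; "`(u)_λ` is the Leray-Hopf weak solution to (1.1) with initial value `(u₀)_λ` with
  the first blow-up epoch `λ⁻²T`" (l.973–974); (4.14nn), (4.17), absorption (4.18) using (EI) for `(u)_λ`,
  scaling identities l.1006–1014 ⇒ **(4.22)** l.1016–1027 — `Step_close` (`Ineq422` = the second line of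
  (4.22), `≤ ½‖u₀‖₂² + ½‖u₀‖²_{Ḣ^{1/2}}`; the third line's `≤ ½‖u₀‖²_{H^{1/2}}` has the constant the wrong
  way round by `≤ √2` — recorded, immaterial).
* "Since (4.22) holds for any fixed `t ∈ (0,T)`, we conclude that `T = ∞`. Moreover, (4.22) and the energy
  inequality (EI) yield (1.2)" (l.1027–1033), with "Let `(0,T)` be the maximal interval where a Leray-Hopf weak
  solution `u` to (1.1) is regular" (l.662) — `Step_T` (the classical local `H^{1/2}` theory / continuation is
  invoked, not displayed).

COMPOSITION: proved as `claim_of_steps` — `Step_L21i → Step_L21ii → Step_L31 → Step_L32 → Step_215 → StepAvg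
→ Step_414n → Step_close → Step_T → ClaimedTheorem` (pure logic; `Step_L21i`, `Step_L31`, `Step_L32` are on
the printed path but enter only through `Step_L21ii` / `Step_414n`, whose printed proofs consume them).

WHAT THIS IS NOT: not a claim about NS regularity or blow-up; not a claim about any author beyond the typed
locator.
-/

open scoped ENNReal NNReal Topology
open _root_.MeasureTheory _root_.Filter FourierTransform

namespace Literature.Claims.NS.Ri2025

open Literature.Analysis.FluidPDE Literature.Analysis.FunctionSpaces

noncomputable section

/-- Physical space `ℝ³`. [folklore] -/
abbrev E3 : Type := EuclideanSpace ℝ (Fin 3)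

/-- Complexified range `ℂ³` for the Fourier side. [folklore] -/
abbrev C3 : Type := EuclideanSpace ℂ (Fin 3)

/-- A real vector field fed to complex Fourier analysis coordinatewise (tree `EuclideanSpace.complexify`).
[folklore] -/
def cplx (w : E3 → E3) : E3 → C3 := fun x => Literature.Analysis.FunctionSpaces.EuclideanSpace.complexify (w x)

/-! ## A. The explicit sequences (2.2), (3.2), (4.1), (4.3) and the averaging bound — VERBATIM def texts
(refuter-5 `RiScaffold.lean`, referee pre-check 2026-08-26T18:57Z) -/

open Classical in
/-- **(2.2)** (l.307–315): "`a(j) := log₂ j` if `j = i + 2^{2^k}` for some `k ∈ ℕ`, `i ∈ ℤ`, `−k ≤ i ≤ k`;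
`1` else" (`ℕ = {1,2,…}`; "Obviously, it holds that `a(j) = 1` for `j ≤ 0`", l.332). Def text verbatim from
refuter-5's scaffold. [cite: Ri2025, (2.2) l.307–315] -/
def a (j : ℤ) : ℝ :=
  if ∃ k : ℕ, 1 ≤ k ∧ |j - 2 ^ (2 ^ k)| ≤ (k : ℤ) then Real.logb 2 j else 1

/-- **(3.2)** (Lemma 3.1, l.526–529): "`b(j) ≡ 2^{−j−1} Σ_{i=1}^{j} 2^i a(i)`, `j ∈ ℕ`". Def text verbatim
from refuter-5's scaffold. [cite: Ri2025, (3.2) l.526–529] -/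
def b (j : ℕ) : ℝ := (∑ i ∈ Finset.Icc 1 j, (2 : ℝ) ^ i * a i) / 2 ^ (j + 1)

/-- **(4.3)** (l.707–710): "`j₀ ≡ j₀(k) = ⌈log₂ k⌉ + 1`" (`ℕ`-valued, `k ≥ 1`). Def text verbatim from
refuter-5's scaffold. [cite: Ri2025, (4.3) l.707–710] -/
def j₀ (k : ℕ) : ℕ := Nat.clog 2 k + 1

open Classical in
/-- **(4.1)** (l.629–632): "`S(n) = {l ∈ ℕ : l ≤ n, −k + 2^{2^k} ≤ l ≤ 2^{2^k} + 2k, ∃ k ∈ ℕ}`" — the window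
levels up to `n` (`k ≥ 1`). [cite: Ri2025, (4.1) l.629–632] -/
def S (n : ℕ) : Finset ℕ :=
  (Finset.Icc 1 n).filter fun l => ∃ k : ℕ, 1 ≤ k ∧ 2 ^ (2 ^ k) - k ≤ l ∧ l ≤ 2 ^ (2 ^ k) + 2 * k

/-- **Lemma 3.1** (l.522–540): "for all `j ∈ ℕ`: `b(j) ≤ log₂ j` if `−k + 2^{2^k} ≤ j ≤ 2^{2^k} + 2k` for some
`k ∈ ℕ`, `2` else" (proof by the recursion `b(j+1) = ½(b(j) + a(j+1))`, l.541–625).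
[claim: Ri2025, status: under-review] -/
def Step_L31 : Prop :=
  ∀ j : ℕ, 1 ≤ j →
    ((∃ k : ℕ, 1 ≤ k ∧ 2 ^ (2 ^ k) - k ≤ j ∧ j ≤ 2 ^ (2 ^ k) + 2 * k) → b j ≤ Real.logb 2 j) ∧
    ((¬ ∃ k : ℕ, 1 ≤ k ∧ 2 ^ (2 ^ k) - k ≤ j ∧ j ≤ 2 ^ (2 ^ k) + 2 * k) → b j ≤ 2)

/-- **Lemma 3.2** (l.635–641): "`|S(n)| ≤ (3 log₂log₂ n + 5) log₂log₂ n / 2`" (for `n ≥ 1`; proof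
l.642–648). [claim: Ri2025, status: under-review] -/
def Step_L32 : Prop :=
  ∀ n : ℕ, 1 ≤ n →
    ((S n).card : ℝ) ≤ (3 * Real.logb 2 (Real.logb 2 n) + 5) * Real.logb 2 (Real.logb 2 n) / 2

/-- **THE AVERAGING BOUND** (§3 Step 2, l.806–839): "Therefore, for all `n ≥ n₀` we have
`Σ_{k=1}^{n} b(j₀(2k)) ≤ 2n + n ≤ 3n`. In the same way, we have `Σ_{k=1}^{n} b(j₀(2k+1)) ≤ 3n`,
`∀ n ∈ ℕ, n ≥ n₀`, with a generic number `n₀ ∈ ℕ` possibly larger than the former `n₀`" (one `n₀` for both,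
WLOG the max). Def text verbatim from refuter-5's scaffold (`StepAvg`); consumed by (2.26n) l.841–852.
[claim: Ri2025, status: under-review] -/
def StepAvg : Prop :=
  ∃ n₀ : ℕ, ∀ n ≥ n₀,
    (∑ k ∈ Finset.Icc 1 n, b (j₀ (2 * k))) ≤ 3 * n ∧ (∑ k ∈ Finset.Icc 1 n, b (j₀ (2 * k + 1))) ≤ 3 * n

/-- The «generic constant» reading of the averaging bound (referee R#b, RETYPE.md §2): "`∃ C, n₀ ∀ n ≥ n₀`,
both sums `≤ C n`". Def text verbatim from refuter-5's scaffold (`StepAvgC`).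
[claim: Ri2025, status: under-review] -/
def StepAvgC : Prop :=
  ∃ C : ℝ, ∃ n₀ : ℕ, ∀ n ≥ n₀,
    (∑ k ∈ Finset.Icc 1 n, b (j₀ (2 * k))) ≤ C * n ∧ (∑ k ∈ Finset.Icc 1 n, b (j₀ (2 * k + 1))) ≤ C * n

/-- The averaging bound FROM a given `n₀` (the body of `StepAvg` with `n₀` exposed, so that (2.26n)'s
`c(n₀)`, `C₂` can depend on it as printed, l.851–852). [cite: Ri2025, l.830–839] -/
def AvgBoundFrom (n₀ : ℕ) : Prop :=
  ∀ n ≥ n₀,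
    (∑ k ∈ Finset.Icc 1 n, b (j₀ (2 * k))) ≤ 3 * n ∧ (∑ k ∈ Finset.Icc 1 n, b (j₀ (2 * k + 1))) ≤ 3 * n

/-- `StepAvg` is `∃ n₀, AvgBoundFrom n₀` (definitional). [cite: Ri2025, l.830–839] -/
theorem stepAvg_iff : StepAvg ↔ ∃ n₀, AvgBoundFrom n₀ := Iff.rfl

/-- The printed bound implies the «generic constant» reading with `C = 3`. [cite: Ri2025, l.830–839] -/
theorem stepAvgC_of_stepAvg (h : StepAvg) : StepAvgC := by
  obtain ⟨n₀, hn⟩ := h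
  exact ⟨3, n₀, hn⟩

/-! ## B. The Fourier-side quantities of §2–§3 (concrete) -/

/-- Weighted Fourier energy of a field on a frequency set: `∫_{ξ ∈ A} |ξ|^{2s} |𝓕v(ξ)|² dξ` (Plancherel
side of `‖·‖_{Ḣ^s}` restricted to `A`; notation l.214–235: `‖u‖_{Ḣ^s} = ‖|ξ|^s û‖₂`, `u^k`, `u_k`,
`u_{h,k}` are Fourier restrictions to `|ξ| ≥ k`, `< k`, `[h,k)`), via Mathlib's `L²` Fourier transform as in
`Literature.Analysis.FunctionSpaces.eHomSobolevSeminorm`; junk value `∞` off `L²`. [cite: Ri2025, (2.1) l.228–235] -/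
def fourierEnergyOn (v : E3 → C3) (A : Set E3) (s : ℝ) : ℝ≥0∞ :=
  open scoped Classical in
  if h : MemLp v 2 (volume : Measure E3) then
    ∫⁻ ξ in A, ‖ξ‖ₑ ^ (2 * s) * ‖((𝓕 (h.toLp v) : Lp C3 2 (volume : Measure E3)) : E3 → C3) ξ‖ₑ ^ 2
  else ∞

/-- `‖u^k‖²_{Ḣ^s}`: energy of the high-frequency part `u^k` (modes `|ξ| ≥ k`, (2.1) l.228–235) with weight
`|ξ|^{2s}` (`s = 0`: `‖u^k‖₂²`; `s = 1`: `‖∇u^k‖₂²`). [cite: Ri2025, (2.1) l.228–235] -/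
def highSq (v : E3 → C3) (k : ℝ) (s : ℝ) : ℝ≥0∞ :=
  fourierEnergyOn v {ξ | k ≤ ‖ξ‖} s

/-- `‖Δ_j v‖₂²` for the sharp dyadic block `2^{j−1} ≤ |ξ| < 2^j` (l.288–291). [cite: Ri2025, §2 l.288–291] -/
def dyadicSq (v : E3 → C3) (j : ℤ) : ℝ≥0∞ :=
  fourierEnergyOn v {ξ | (2 : ℝ) ^ (j - 1) ≤ ‖ξ‖ ∧ ‖ξ‖ < (2 : ℝ) ^ j} 0

/-- **The `X₁` norm** (2.3) (l.316–326): `‖v‖_{X₁} = ‖{2^{j/2} a(j)⁻¹ ‖Δ_j v‖₂}_{j∈ℤ}‖_{ℓ²}`, i.e.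
`‖v‖²_{X₁} = Σ_j 2^j a(j)⁻² ‖Δ_j v‖₂²` ("`Ḣ^{1/2} ↪ X₁`, `‖v‖_{X₁} ≤ ‖v‖_{Ḣ^{1/2}}`", l.333–334). In
`ℝ≥0∞` (`tsum` of nonnegative terms: no junk). [cite: Ri2025, (2.3) l.316–326] -/
def eX1Norm (v : E3 → C3) : ℝ≥0∞ :=
  (∑' j : ℤ, ENNReal.ofReal ((2 : ℝ) ^ j / a j ^ 2) * dyadicSq v j) ^ (1 / 2 : ℝ)

/-! ## C. The claimed statement -/

/-- **Conclusion of Theorem 1.1 on a horizon `[0,T)`** (l.193–209): the solution is regular on `(0,T)`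
("Thus `u` is globally regular" — rendered as: classical on `(0,T) × ℝ³` for some pressure, the reading used by
the tree's `ess_endpoint` / `ladyzhenskaya_prodi_serrin`) and (1.2) holds for `t ∈ (0,T)`:
`‖u(t)‖²_{H^{1/2}} + ν∫₀ᵗ‖u(τ)‖²_{H^{3/2}} dτ ≤ 2‖u₀‖²_{H^{1/2}}` (inhomogeneous norms
`Function.eSobolevNorm`). [claim: Ri2025, status: under-review] -/
def Conclusion11 (ν T : ℝ) (u₀ : E3 → E3) (u : ℝ → E3 → E3) : Prop :=
  (∃ p : ℝ → E3 → ℝ, IsClassicalNSSolutionOn (Set.Ioo 0 T) ν 0 u p) ∧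
    ∀ t ∈ Set.Ioo 0 T,
      Function.eSobolevNorm (1 / 2 : ℝ) (cplx (u t)) ^ 2 +
          ENNReal.ofReal ν * ∫⁻ τ in Set.Ioo 0 t, Function.eSobolevNorm (3 / 2 : ℝ) (cplx (u τ)) ^ 2 ≤
        2 * Function.eSobolevNorm (1 / 2 : ℝ) (cplx u₀) ^ 2

/-- **Theorem 1.1** (l.193–209), AS PRINTED, per horizon: for every `ν > 0`, `T > 0`, every datum
`u₀ ∈ H^{1/2}(ℝ³)` (`MemFourierSobolev (1/2)`), weakly divergence-free, and EVERY Leray–Hopf weak solution `u`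
of (1.1) (`f ≡ 0`) on `[0,T)` with datum `u₀`: `u` is regular on `(0,T)` and (1.2) holds for `t ∈ (0,T)`
("`u ∈ L^∞(0,∞;H^{1/2}) ∩ L²(0,∞;H^{3/2})`" is the content of (1.2) for all `T`).
[claim: Ri2025, status: under-review] -/
def ClaimedTheorem : Prop :=
  ∀ ν : ℝ, 0 < ν → ∀ T : ℝ, 0 < T → ∀ u₀ : E3 → E3,
    MemFourierSobolev (1 / 2 : ℝ) (cplx u₀) → IsWeaklyDivFree u₀ →
    ∀ u : ℝ → E3 → E3, IsLerayHopfOn T ν 0 u₀ u → Conclusion11 ν T u₀ u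

/-- **The `L^∞_t H^{1/2}_x` bound in the shape of the tree's bridge to Clay (A)** (hypothesis `H` of the
summit-side `StrongHypotheses.navierStokesRegularity_of_lerayHopfSobolevHalfBound`, restricted to `H^{1/2}`
data): every Leray–Hopf solution from an `H^{1/2}` weakly divergence-free datum has
`‖u(t)‖_{H^{1/2}} ≤ M` for a.e. `t ∈ (0,T)`. [claim: Ri2025, status: under-review] -/
def ClaimedLinftyHalfBound : Prop :=
  ∀ ν : ℝ, 0 < ν → ∀ T : ℝ, 0 < T → ∀ u₀ : E3 → E3,
    MemFourierSobolev (1 / 2 : ℝ) (cplx u₀) → IsWeaklyDivFree u₀ →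
    ∀ u : ℝ → E3 → E3, IsLerayHopfOn T ν 0 u₀ u →
      ∃ M : ℝ≥0∞, M < ∞ ∧ ∀ t ∈ Set.Ioo 0 T, Function.eSobolevNorm (1 / 2 : ℝ) (cplx (u t)) ≤ M

/-- (1.2) gives the `L^∞_t H^{1/2}_x` bound with `M = (2‖u₀‖²_{H^{1/2}})^{1/2} < ∞` (the datum is in
`H^{1/2}`). Elementary `ℝ≥0∞` algebra. [cite: Ri2025, Thm 1.1 (1.2) l.193–209] -/
theorem linftyHalfBound_of_claimedTheorem (h : ClaimedTheorem) : ClaimedLinftyHalfBound := by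
  intro ν hν T hT u₀ hu₀ hdiv u hLH
  obtain ⟨-, h12⟩ := h ν hν T hT u₀ hu₀ hdiv u hLH
  refine ⟨(2 * Function.eSobolevNorm (1 / 2 : ℝ) (cplx u₀) ^ 2) ^ (1 / 2 : ℝ), ?_, fun t ht => ?_⟩
  · obtain ⟨hmem, hfin⟩ := hu₀
    have hlt : Function.eSobolevNorm (1 / 2 : ℝ) (cplx u₀) < ∞ := by
      unfold Function.eSobolevNorm
      rw [dif_pos hmem]
      exact hfin
    refine ENNReal.rpow_lt_top_of_nonneg (by norm_num) ?_
    exact ENNReal.mul_ne_top (by norm_num) (ENNReal.pow_ne_top hlt.ne)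
  · have hle : Function.eSobolevNorm (1 / 2 : ℝ) (cplx (u t)) ^ 2 ≤
        2 * Function.eSobolevNorm (1 / 2 : ℝ) (cplx u₀) ^ 2 :=
      le_trans le_self_add (h12 t ht)
    calc Function.eSobolevNorm (1 / 2 : ℝ) (cplx (u t))
        = (Function.eSobolevNorm (1 / 2 : ℝ) (cplx (u t)) ^ 2) ^ (1 / 2 : ℝ) := by
          rw [← ENNReal.rpow_natCast, ← ENNReal.rpow_mul]
          norm_num
      _ ≤ (2 * Function.eSobolevNorm (1 / 2 : ℝ) (cplx u₀) ^ 2) ^ (1 / 2 : ℝ) :=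
          ENNReal.rpow_le_rpow hle (by norm_num)

/-! ## D. Regularity runs and the displayed inequalities (2.15), (4.14n), (4.22) -/

/-- **A regularity run** ("Let `(0,T)` be the maximal interval where a Leray-Hopf weak solution `u` to (1.1)
is regular", l.662; maximality is used only in `Step_T`): `ν > 0`, `0 < T' ≤ T`, datum
`u₀ ∈ H^{1/2}` weakly divergence-free, `u` Leray–Hopf on `[0,T)` and classical on `(0,T')` with pressure `p`.
[cite: Ri2025, l.660–662] -/
def IsRegularRun (ν T T' : ℝ) (u₀ : E3 → E3) (u : ℝ → E3 → E3) (p : ℝ → E3 → ℝ) : Prop :=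
  0 < ν ∧ 0 < T' ∧ T' ≤ T ∧ MemFourierSobolev (1 / 2 : ℝ) (cplx u₀) ∧ IsWeaklyDivFree u₀ ∧
    IsLerayHopfOn T ν 0 u₀ u ∧ IsClassicalNSSolutionOn (Set.Ioo 0 T') ν 0 u p

/-- **(2.15)** (l.754–762) at constant `C₁`, for the run `u` with datum `u₀`, mode `k ≥ 1`, time `t`,
INTEGRATED on `(0,t)` (the form in which (2.5)/(4.13) are integrated at (4.12), l.886):
`½‖u^k(t)‖₂² + ν∫₀ᵗ‖∇u^k‖₂² ≤ ½‖u₀^k‖₂² + 4C₁ b(j₀(k)) ∫₀ᵗ ‖u(τ)‖_{X₁} ‖∇u^{k/2}(τ)‖₂² dτ` (printed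
differential form: "`d/2dt ‖u^k‖₂² + ν‖∇u^k‖₂² ≤ C₁b(j₀(k))k²‖u‖_{X₁}‖u^{k/2}‖₂² ≤
4C₁b(j₀(k))‖u‖_{X₁}‖∇u^{k/2}‖₂², ∀ k ≥ 1`, in `(0,T)`"). [cite: Ri2025, (2.15) l.754–762] -/
def Ineq215 (C₁ ν : ℝ) (u₀ : E3 → E3) (u : ℝ → E3 → E3) (k : ℕ) (t : ℝ) : Prop :=
  (1 / 2 : ℝ≥0∞) * highSq (cplx (u t)) k 0 + ENNReal.ofReal ν * ∫⁻ τ in Set.Ioo 0 t, highSq (cplx (u τ)) k 1 ≤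
    (1 / 2 : ℝ≥0∞) * highSq (cplx u₀) k 0 +
      ENNReal.ofReal (4 * C₁ * b (j₀ k)) *
        ∫⁻ τ in Set.Ioo 0 t, eX1Norm (cplx (u τ)) * highSq (cplx (u τ)) ((k : ℝ) / 2) 1

/-- **Step (2.15)** = Step 1 of the proof (l.660–763: testing (1.1) with `u^k`, the cancellation
`((u·∇)u^k, u^k) = 0` l.666–676, the bounds l.686–704, Bernstein-type bounds via `b(j₀(k))` and `X₁`
l.711–752): "with a generic constant `C₁ > 0` independent of `ν`" (l.762) — `∃ C₁ > 0` BEFORE all data —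
(2.15) holds for every regularity run, every `k ≥ 1`, every `t` in the regularity interval.
[claim: Ri2025, status: under-review] -/
def Step_215 : Prop :=
  ∃ C₁ : ℝ, 0 < C₁ ∧ ∀ (ν T T' : ℝ) (u₀ : E3 → E3) (u : ℝ → E3 → E3) (p : ℝ → E3 → ℝ),
    IsRegularRun ν T T' u₀ u p → ∀ k : ℕ, 1 ≤ k → ∀ t ∈ Set.Ioo 0 T', Ineq215 C₁ ν u₀ u k t

/-- **(4.14n)** (l.932–949) at constant `C₂` for the run `u` with datum `u₀` at time `t`:
`½‖u(t)‖²_{Ḣ^{1/2}} + ν∫₀ᵗ‖u‖²_{Ḣ^{3/2}} ≤ ½‖u₀‖₂² + ½‖u₀‖²_{Ḣ^{1/2}} +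
C₂∫₀ᵗ‖u(τ)‖_{X₁}(‖∇u(τ)‖₂² + ‖u(τ)‖²_{Ḣ^{3/2}}) dτ` (second printed line, after (EI)); `‖∇u‖₂²` is
rendered as the `Ḣ¹` seminorm squared (Plancherel). [cite: Ri2025, (4.14n) l.932–949] -/
def Ineq414n (C₂ ν : ℝ) (u₀ : E3 → E3) (u : ℝ → E3 → E3) (t : ℝ) : Prop :=
  (1 / 2 : ℝ≥0∞) * Function.eHomSobolevSeminorm (1 / 2 : ℝ) (cplx (u t)) ^ 2 +
      ENNReal.ofReal ν * ∫⁻ τ in Set.Ioo 0 t, Function.eHomSobolevSeminorm (3 / 2 : ℝ) (cplx (u τ)) ^ 2 ≤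
    (1 / 2 : ℝ≥0∞) * eLpNorm u₀ 2 (volume : Measure E3) ^ 2 +
      (1 / 2 : ℝ≥0∞) * Function.eHomSobolevSeminorm (1 / 2 : ℝ) (cplx u₀) ^ 2 +
      ENNReal.ofReal C₂ * ∫⁻ τ in Set.Ioo 0 t, eX1Norm (cplx (u τ)) *
        (Function.eHomSobolevSeminorm 1 (cplx (u τ)) ^ 2 +
          Function.eHomSobolevSeminorm (3 / 2 : ℝ) (cplx (u τ)) ^ 2)

/-- **Step (4.14n) = Step 2 up to the rescaling** (l.765–949: summation of (2.15) over `k` (2.5), the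
identities (2.25), the re-summation (2.26) l.779–805, **(2.26n)** l.841–852 "`Σ_k b(j₀(k))‖∇u^{k/2}‖₂² ≤
c(n₀)‖∇u‖₂² + 6Σ_{n≥n₀} n‖∇u_{n,n+1}‖₂²`, where `c(n₀)` is a generic constant depending only on `n₀`",
(4.13) l.857–868 "`C₂ > 0` a generic constant", integration (4.12) l.886, (4.14) l.909–921, (4.2) l.924,
summation (4.14n) l.932–949): GIVEN (2.15) at a constant `C₁` for all runs and the averaging bound from `n₀`,
there is `C₂ > 0` with (4.14n) on every regularity run. (2.26n) consumes exactly
"`Σ_{k=1}^{n}(b(j₀(2k)) + b(j₀(2k+1))) ≤ 6n` for `n ≥ n₀`" (referee F5). [claim: Ri2025, status: under-review] -/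
def Step_414n : Prop :=
  ∀ (C₁ : ℝ) (n₀ : ℕ), 0 < C₁ →
    (∀ (ν T T' : ℝ) (u₀ : E3 → E3) (u : ℝ → E3 → E3) (p : ℝ → E3 → ℝ),
      IsRegularRun ν T T' u₀ u p → ∀ k : ℕ, 1 ≤ k → ∀ t ∈ Set.Ioo 0 T', Ineq215 C₁ ν u₀ u k t) →
    AvgBoundFrom n₀ →
    ∃ C₂ : ℝ, 0 < C₂ ∧ ∀ (ν T T' : ℝ) (u₀ : E3 → E3) (u : ℝ → E3 → E3) (p : ℝ → E3 → ℝ),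
      IsRegularRun ν T T' u₀ u p → ∀ t ∈ Set.Ioo 0 T', Ineq414n C₂ ν u₀ u t

/-- **Lemma 2.1 (i)** (l.336–352): "Let `v ∈ Ḣ^{1/2}(ℝ³)`. Then `∀ ε > 0 ∃ l₀ := max{M+1,
log₂[log₂M ‖v‖_{X₁}/ε] + 1} > 0`: `‖λv(λ·)‖_{X₁} ≤ ε ∀ λ = 2^{2^{2^l}} (l ≥ l₀)`, where `M > 0` is such that
`Σ_{|j|≥M} 2^j‖Δ_j v‖₂² ≤ ε²/2` (4.4)" — typed with `∃ l₀` (the explicit formula is the proof's choice);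
`λv(λ·)` = the tree's `nsRescaleData λ v`; `v ∈ Ḣ^{1/2}` rendered as `MemHomSobolev (1/2)` (`Ḣ^{1/2} ∩ L²`,
the tree's function-level class). Proof l.361–484. [claim: Ri2025, status: under-review] -/
def Step_L21i : Prop :=
  ∀ v : E3 → E3, MemHomSobolev (1 / 2 : ℝ) (cplx v) → ∀ ε : ℝ, 0 < ε →
    ∃ l₀ : ℕ, ∀ l : ℕ, l₀ ≤ l →
      eX1Norm (cplx (nsRescaleData ((2 : ℝ) ^ (2 ^ (2 ^ l))) v)) ≤ ENNReal.ofReal ε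

/-- **Lemma 2.1 (ii)** (l.353–360, proof l.485–519) IN THE FORM THE CLOSE INVOKES IT (l.950–957: "fix
`t ∈ (0,T)`. By Lemma 2.1 (ii) in view of `u ∈ C([0,t], Ḣ^{1/2}(ℝ³))` there exists `l₀(t) > 0` such that
(4.16) `‖λu(τ,λ·)‖_{X₁} ≤ ε, ∀ τ ∈ [0,t], ∀ λ = 2^{2^{2^l}} (l ≥ l₀(t))`"): for every regularity run and every
`t` in the regularity interval, uniform-in-`τ ∈ [0,t]` rescaling smallness. (The printed hypothesis of (ii)
is `u ∈ C([0,T], Ḣ^{1/2})`; its verification for a Leray–Hopf solution regular on `(0,T')` from `H^{1/2}` data,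
up to `τ = 0`, is invoked "in view of", not displayed.) [claim: Ri2025, status: under-review] -/
def Step_L21ii : Prop :=
  ∀ (ν T T' : ℝ) (u₀ : E3 → E3) (u : ℝ → E3 → E3) (p : ℝ → E3 → ℝ), IsRegularRun ν T T' u₀ u p →
    ∀ t ∈ Set.Ioo 0 T', ∀ ε : ℝ, 0 < ε → ∃ l₀ : ℕ, ∀ l : ℕ, l₀ ≤ l → ∀ τ ∈ Set.Icc 0 t,
      eX1Norm (cplx (nsRescaleData ((2 : ℝ) ^ (2 ^ (2 ^ l))) (u τ))) ≤ ENNReal.ofReal ε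

/-- **(4.22)** (l.1016–1027, second line) for the run `u` with datum `u₀` at time `t`:
`½‖u(t)‖²_{Ḣ^{1/2}} + (ν/2)∫₀ᵗ‖u(τ)‖²_{Ḣ^{3/2}} dτ ≤ ½‖u₀‖₂² + ½‖u₀‖²_{Ḣ^{1/2}}` (first line:
`≤ λ⁻¹‖u₀‖₂² + ½‖u₀‖²_{Ḣ^{1/2}}`, weakened "due to `λ > 2`"; the third line `≤ ½‖u₀‖²_{H^{1/2}}` inverts a
`√2`-constant and is not typed). [cite: Ri2025, (4.22) l.1016–1027] -/
def Ineq422 (ν : ℝ) (u₀ : E3 → E3) (u : ℝ → E3 → E3) (t : ℝ) : Prop :=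
  (1 / 2 : ℝ≥0∞) * Function.eHomSobolevSeminorm (1 / 2 : ℝ) (cplx (u t)) ^ 2 +
      ENNReal.ofReal (ν / 2) * ∫⁻ τ in Set.Ioo 0 t, Function.eHomSobolevSeminorm (3 / 2 : ℝ) (cplx (u τ)) ^ 2 ≤
    (1 / 2 : ℝ≥0∞) * eLpNorm u₀ 2 (volume : Measure E3) ^ 2 +
      (1 / 2 : ℝ≥0∞) * Function.eHomSobolevSeminorm (1 / 2 : ℝ) (cplx u₀) ^ 2

/-- **Step (close) = the rescaling argument** (l.958–1027): GIVEN (4.14n) with a FIXED `C₂` for every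
regularity run (so in particular for the rescaled run — "Since `(u)_λ` is the Leray-Hopf weak solution to
(1.1) with initial value `(u₀)_λ` with the first blow-up epoch `λ⁻²T`, we have by (4.14n) that (4.14nn)",
l.973–977; `(u)_λ(τ,x) := λu(λ²τ,λx)` (4.19) = tree `nsRescale`) and GIVEN the smallness (4.16) at
`ε = ν/(2C₂)` for `λ = 2^{2^{2^l}}` ("(4.16) implies (4.17)", l.967–971), the absorption (4.18) ("where we used
energy inequality for `(u)_λ`", l.1002–1004) and the scaling identities l.1006–1014 give (4.22) at `t`.
[claim: Ri2025, status: under-review] -/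
def Step_close : Prop :=
  ∀ C₂ : ℝ, 0 < C₂ →
    (∀ (ν T T' : ℝ) (u₀ : E3 → E3) (u : ℝ → E3 → E3) (p : ℝ → E3 → ℝ),
      IsRegularRun ν T T' u₀ u p → ∀ t ∈ Set.Ioo 0 T', Ineq414n C₂ ν u₀ u t) →
    ∀ (ν T T' : ℝ) (u₀ : E3 → E3) (u : ℝ → E3 → E3) (p : ℝ → E3 → ℝ), IsRegularRun ν T T' u₀ u p →
      ∀ t ∈ Set.Ioo 0 T', ∀ l : ℕ,
        (∀ τ ∈ Set.Icc 0 t,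
          eX1Norm (cplx (nsRescaleData ((2 : ℝ) ^ (2 ^ (2 ^ l))) (u τ))) ≤ ENNReal.ofReal (ν / (2 * C₂))) →
        Ineq422 ν u₀ u t

/-- **Step (T = ∞)** (l.662: "Let `(0,T)` be the maximal interval where a Leray-Hopf weak solution `u` to (1.1)
is regular"; l.1027–1033: "Since (4.22) holds for any fixed `t ∈ (0,T)`, we conclude that `T = ∞`. Moreover,
(4.22) and the energy inequality (EI) yield (1.2)"): IF (4.22) holds on every regularity interval `(0,T')`,
`T' ≤ T`, of a Leray–Hopf solution on `[0,T)` from an `H^{1/2}` datum, THEN the solution is regular on all of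
`(0,T)` and (1.2) holds there. (Local `H^{1/2}` regularity, continuation from a critical a priori bound and
(1.2) from (4.22)+(EI) — incl. the `L²_tL²_x` part of `∫‖u‖²_{H^{3/2}}` — are invoked, not displayed.)
[claim: Ri2025, status: under-review] -/
def Step_T : Prop :=
  ∀ ν : ℝ, 0 < ν → ∀ T : ℝ, 0 < T → ∀ u₀ : E3 → E3,
    MemFourierSobolev (1 / 2 : ℝ) (cplx u₀) → IsWeaklyDivFree u₀ →
    ∀ u : ℝ → E3 → E3, IsLerayHopfOn T ν 0 u₀ u →
      (∀ (T' : ℝ) (p : ℝ → E3 → ℝ), 0 < T' → T' ≤ T → IsClassicalNSSolutionOn (Set.Ioo 0 T') ν 0 u p →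
        ∀ t ∈ Set.Ioo 0 T', Ineq422 ν u₀ u t) →
      Conclusion11 ν T u₀ u

/-! ## E. Composition -/

/-- **(4.22) on every regularity interval, from the steps** (Step 1, Step 2, the averaging bound and the
close; l.660–1027): the averaging bound supplies `n₀`, (2.15) supplies `C₁`, (4.14n) a FIXED `C₂`; for a run
and `t`, Lemma 2.1(ii) at `ε = ν/(2C₂)` supplies `l₀`, and the close at `l = l₀` gives (4.22). Pure logic.
[cite: Ri2025, l.950–1027] -/
theorem ineq422_of_steps (h21ii : Step_L21ii) (h215 : Step_215) (hAvg : StepAvg) (h414 : Step_414n)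
    (hcl : Step_close) {ν T T' : ℝ} {u₀ : E3 → E3} {u : ℝ → E3 → E3} {p : ℝ → E3 → ℝ}
    (hrun : IsRegularRun ν T T' u₀ u p) {t : ℝ} (ht : t ∈ Set.Ioo 0 T') : Ineq422 ν u₀ u t := by
  obtain ⟨C₁, hC₁, h215'⟩ := h215
  obtain ⟨n₀, hav⟩ := hAvg
  obtain ⟨C₂, hC₂, h414'⟩ := h414 C₁ n₀ hC₁ h215' hav
  have hν : 0 < ν := hrun.1
  obtain ⟨l₀, hl₀⟩ := h21ii ν T T' u₀ u p hrun t ht (ν / (2 * C₂)) (by positivity)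
  exact hcl C₂ hC₂ h414' ν T T' u₀ u p hrun t ht l₀ (hl₀ l₀ le_rfl)

/-- **COMPOSITION** (the paper's logic composes): Lemma 2.1 (i)(ii), Lemmas 3.1–3.2, (2.15), THE AVERAGING
BOUND, (4.14n), the rescaling close and the `T = ∞` step imply Theorem 1.1. Lemma 2.1(i), 3.1, 3.2 are on the
printed path (consumed by the printed proofs of Lemma 2.1(ii), of the averaging bound and of (2.26n)) but
enter the kernel composition only through `Step_L21ii` / `StepAvg` / `Step_414n`. Pure logic.
[claim: Ri2025, status: under-review] -/
theorem claim_of_steps (_h21i : Step_L21i) (h21ii : Step_L21ii) (_h31 : Step_L31) (_h32 : Step_L32)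
    (h215 : Step_215) (hAvg : StepAvg) (h414 : Step_414n) (hcl : Step_close) (hT : Step_T) :
    ClaimedTheorem := by
  intro ν hν T hTpos u₀ hu₀ hdiv u hLH
  refine hT ν hν T hTpos u₀ hu₀ hdiv u hLH ?_
  intro T' p hT' hT'T hcls t ht
  exact ineq422_of_steps h21ii h215 hAvg h414 hcl ⟨hν, hT', hT'T, hu₀, hdiv, hLH, hcls⟩ ht


/-! ## F. Rev 2 (append-only): the support of the averaging bound at display grain (l.806–839;
print p.12 bottom – p.13 top) — hand-over of ns-claims-typist-9 (draft `claims/Ri2025/Ri2025-typist9-draft.lean`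
sha16 01690049fc931bca, 2026-08-26T20:01Z; its texts, re-targeted at the landed `a`/`b`/`j₀`/`S`/`StepAvg`)

Print pagination (typist-9's renders `claims/Ri2025/pdf-pages-typist9/`, README table): printed equation
numbers differ from the TeX labels used above — (2.2) p.5; Lemma 2.1 p.5–6; (3.1) [TeX (3.2), `b`] and
Lemma 3.1 p.8; (3.5) [TeX (4.1), `S`] and Lemma 3.2 p.10; (3.8) [TeX (4.3), `j₀`] p.11; (3.9) [TeX (2.15)]
p.11–12; the averaging bound p.12 bottom / p.13 top; (3.13) [TeX (2.26n)] p.13; (3.14) [TeX (4.13)] p.13;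
(3.18) [TeX (4.14n)] p.14; (3.19)–(3.20) [TeX (4.16)–(4.19)] p.14; (3.21)–(3.24) [TeX (4.14nn)–(4.22)] p.15;
«T = ∞» p.15; Thm 1.1 with (1.2) p.3.

The printed derivation of the even half of `StepAvg` (l.806–833): "Note that `j₀(2k) = ⌈log₂ k⌉ + 2` …
`Σ_{k=1}^{n} b(j₀(2k)) = Σ_{k≤n, j₀(2k)∉S(⌈log₂n⌉+2)} b(j₀(2k)) + Σ_{k≤n, j₀(2k)∈S(⌈log₂n⌉+2)} b(j₀(2k))`,
where, by Lemma 3.1, `Σ_{k≤n, j₀(2k)∉S(…)} b(j₀(2k)) ≤ 2n`. Moreover, we have by (3.5) and Lemma 3.2 that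
`Σ_{k≤n, j₀(2k)∈S(⌈log₂n⌉+2)} b(j₀(2k)) ≤ |S(⌈log₂n⌉+2)| · max_{k≤n, j₀(2k)∈S(⌈log₂n⌉+2)} b(j₀(2k))
≤ |S(⌈log₂n⌉+2)| · log₂(⌈log₂n⌉+2) ≤ (3log₂log₂(⌈log₂n⌉+2)+5)/2 · log₂log₂(⌈log₂n⌉+2) · log₂(⌈log₂n⌉+2)
≤ n, ∀ n ≥ n₀`, for some generic number `n₀ ∈ ℕ`. Therefore, for all `n ≥ n₀` we have
`Σ_{k=1}^{n} b(j₀(2k)) ≤ 2n + n ≤ 3n`. In the same way, we have `Σ_{k=1}^{n} b(j₀(2k+1)) ≤ 3n, ∀ n ≥ n₀`."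
Typed below: the split (`offWindowSum`, `windowSum`, `sum_b_j₀_eq` PROVED), the off-window bound
`Step_avgOffWindow` (l.812–816), THE LEVEL-COUNT INEQUALITY `Step_avgLevelCount` (l.817–821, first two
lines of the display: a sum over the INDICES `k` bounded by (number of LEVELS) × (max summand)) with its
abstract shape `LevelCountPattern`, the growth line `Step_avgGrowth` (l.822–826), the odd half "in the same
way" `StepAvgOdd` (l.834–839); and the kernel facts `windowBound_of_support` (level-count ∧ Lemma 3.2 ∧
growth ⇒ the window bound `≤ n` eventually, l.817–829) and `stepAvg_of_support` (split + off-window + window +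
odd ⇒ `StepAvg`, l.830–839), so that `claim_of_support_steps` composes Theorem 1.1 from the steps with the
averaging bound REPLACED by its displayed support — the level-count inequality is then ON PATH. -/

/-- The off-window part `Σ_{k ≤ n, j₀(2k) ∉ S(⌈log₂n⌉+2)} b(j₀(2k))` of the split of `Σ_{k=1}^{n} b(j₀(2k))`
(l.807–811; `⌈log₂ n⌉ = Nat.clog 2 n`). Text: typist-9. [cite: Ri2025, §3 Step 2, l.807–811 (print p.12)] -/
def offWindowSum (n : ℕ) : ℝ :=
  open scoped Classical in
  ∑ k ∈ (Finset.Icc 1 n).filter (fun k => j₀ (2 * k) ∉ S (Nat.clog 2 n + 2)), b (j₀ (2 * k))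

/-- The window part `Σ_{k ≤ n, j₀(2k) ∈ S(⌈log₂n⌉+2)} b(j₀(2k))` of the same split (l.807–811). Text:
typist-9. [cite: Ri2025, §3 Step 2, l.807–811 (print p.12)] -/
def windowSum (n : ℕ) : ℝ :=
  open scoped Classical in
  ∑ k ∈ (Finset.Icc 1 n).filter (fun k => j₀ (2 * k) ∈ S (Nat.clog 2 n + 2)), b (j₀ (2 * k))

/-- The split identity (l.807–811): `Σ_{k=1}^{n} b(j₀(2k)) = offWindowSum n + windowSum n`
(`Finset.sum_filter_add_sum_filter_not`). Text: typist-9. [cite: Ri2025, §3 Step 2, l.807–811 (print p.12)] -/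
theorem sum_b_j₀_eq (n : ℕ) :
    ∑ k ∈ Finset.Icc 1 n, b (j₀ (2 * k)) = offWindowSum n + windowSum n := by
  classical
  unfold offWindowSum windowSum
  rw [add_comm, Finset.sum_filter_add_sum_filter_not]

/-- **Off-window bound** (l.812–816): "where, by Lemma 3.1, `Σ_{k≤n, j₀(2k)∉S(⌈log₂n⌉+2)} b(j₀(2k)) ≤ 2n`"
(every `n`; off-window levels have `b ≤ 2`). Text: typist-9 (`Step9_OffWindowBound`).
[claim: Ri2025, status: under-review] -/
def Step_avgOffWindow : Prop :=
  ∀ n : ℕ, 1 ≤ n → offWindowSum n ≤ 2 * n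

/-- **THE LEVEL-COUNT INEQUALITY** (l.817–821, first two lines of the display; print p.13 top):
"`Σ_{k≤n, j₀(2k)∈S(⌈log₂n⌉+2)} b(j₀(2k)) ≤ |S(⌈log₂n⌉+2)| · max_{k≤n, j₀(2k)∈S(⌈log₂n⌉+2)} b(j₀(2k))
≤ |S(⌈log₂n⌉+2)| · log₂(⌈log₂n⌉+2)`" (the second by Lemma 3.1), typed end-to-end for every `n` (no
quantifier restriction is printed before the last line of the display). The left sum runs over the INDICES
`k ≤ n` — a window level `l = j₀(2k)` is attained by every `k` with `⌈log₂ k⌉ + 2 = l`, i.e. by `2^{l−3}`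
indices — whereas the right side multiplies the maximal summand by the number `|S|` of LEVELS. Text:
typist-9 (`Step10_LevelCountBound`). [claim: Ri2025, status: under-review] -/
def Step_avgLevelCount : Prop :=
  ∀ n : ℕ, 1 ≤ n →
    windowSum n ≤ ((S (Nat.clog 2 n + 2)).card : ℝ) * Real.logb 2 ((Nat.clog 2 n + 2 : ℕ) : ℝ)

/-- The «eventually» reading of the level-count inequality (charitable twin, TYPING-HYGIENE 4: the display's
only printed quantifier, "`∀ n ≥ n₀`" on its last line, extended to the whole chain).
[claim: Ri2025, status: under-review] -/
def Step_avgLevelCountEv : Prop :=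
  ∃ n₀ : ℕ, ∀ n ≥ n₀,
    windowSum n ≤ ((S (Nat.clog 2 n + 2)).card : ℝ) * Real.logb 2 ((Nat.clog 2 n + 2 : ℕ) : ℝ)

/-- The printed form implies the eventual form. [cite: Ri2025, §3 Step 2, l.817–821] -/
theorem stepAvgLevelCountEv_of_levelCount (h : Step_avgLevelCount) : Step_avgLevelCountEv :=
  ⟨1, fun n hn => h n hn⟩

/-- The ABSTRACT SHAPE of the level-count inference (cell rule F15: the lemma over `ℕ/ℝ` the display uses; not
printed as a lemma): a sum `Σ_{k∈K} f(g k)` indexed through a level map `g : K → T` with summands `≤ M` is at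
most `|T| · M` — valid when `g` is injective on `K`; l.817–821 applies it with `K = {k ≤ n : j₀(2k) ∈ S(…)}`,
`g = j₀(2·)` (far from injective), `T = S(⌈log₂n⌉+2)`, `f = b`. Text: typist-9 (`Step10_LevelCountPattern`).
[claim: Ri2025, status: under-review] -/
def LevelCountPattern : Prop :=
  ∀ (K T : Finset ℕ) (g : ℕ → ℕ) (f : ℕ → ℝ) (M : ℝ),
    (∀ k ∈ K, g k ∈ T) → (∀ k ∈ K, f (g k) ≤ M) → ∑ k ∈ K, f (g k) ≤ (T.card : ℝ) * M

/-- **The growth line** (l.822–826, third and fourth lines of the display): "`≤ (3log₂log₂(⌈log₂n⌉+2)+5)/2 ·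
log₂log₂(⌈log₂n⌉+2) · log₂(⌈log₂n⌉+2) ≤ n, ∀ n ≥ n₀`, for some generic number `n₀ ∈ ℕ`" — the elementary
eventual inequality (iterated logarithms against `n`), typed as the last inequality of the chain.
[claim: Ri2025, status: under-review] -/
def Step_avgGrowth : Prop :=
  ∃ n₀ : ℕ, ∀ n ≥ n₀,
    (3 * Real.logb 2 (Real.logb 2 ((Nat.clog 2 n + 2 : ℕ) : ℝ)) + 5) *
          Real.logb 2 (Real.logb 2 ((Nat.clog 2 n + 2 : ℕ) : ℝ)) / 2 *
        Real.logb 2 ((Nat.clog 2 n + 2 : ℕ) : ℝ) ≤ n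

/-- **The window bound** (the display's end-to-end conclusion, l.817–829): "`Σ_{k≤n, j₀(2k)∈S(⌈log₂n⌉+2)}
b(j₀(2k)) ≤ … ≤ n, ∀ n ≥ n₀`". Text: typist-9 (`Step11_WindowBound`). In the kernel it FOLLOWS from
`Step_avgLevelCount`, Lemma 3.2 and `Step_avgGrowth` (`windowBound_of_support`), so it is not an independent
step of `claim_of_support_steps`. [claim: Ri2025, status: under-review] -/
def Step_avgWindow : Prop :=
  ∃ n₀ : ℕ, ∀ n ≥ n₀, windowSum n ≤ n

/-- **The odd half, "in the same way"** (l.834–839): "`Σ_{k=1}^{n} b(j₀(2k+1)) ≤ 3n, ∀ n ∈ ℕ, n ≥ n₀`, with a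
generic number `n₀ ∈ ℕ` possibly larger than the former `n₀`" — no derivation displayed; typed as asserted.
[claim: Ri2025, status: under-review] -/
def StepAvgOdd : Prop :=
  ∃ n₀ : ℕ, ∀ n ≥ n₀, (∑ k ∈ Finset.Icc 1 n, b (j₀ (2 * k + 1))) ≤ 3 * n

/-- **l.817–829 in the kernel**: the level-count inequality (eventual form), Lemma 3.2 (at
`N = ⌈log₂ n⌉ + 2 ≥ 1`) and the growth line give the window bound `windowSum n ≤ n` for `n ≥ n₀`. Real
arithmetic (`log₂ N ≥ 0` for `N ≥ 1`). [cite: Ri2025, §3 Step 2, l.817–829 (print p.13)] -/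
theorem windowBound_of_support (hlc : Step_avgLevelCountEv) (h32 : Step_L32) (hgr : Step_avgGrowth) :
    Step_avgWindow := by
  obtain ⟨n₁, hn₁⟩ := hlc
  obtain ⟨n₂, hn₂⟩ := hgr
  refine ⟨max n₁ n₂, fun n hn => ?_⟩
  have h1 : n₁ ≤ n := le_trans (le_max_left _ _) hn
  have h2 : n₂ ≤ n := le_trans (le_max_right _ _) hn
  set N : ℕ := Nat.clog 2 n + 2 with hN
  have hN1 : 1 ≤ N := by omega
  have hlogN : 0 ≤ Real.logb 2 ((N : ℕ) : ℝ) :=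
    Real.logb_nonneg (by norm_num) (by exact_mod_cast hN1)
  have hcard := h32 N hN1
  calc windowSum n ≤ ((S N).card : ℝ) * Real.logb 2 ((N : ℕ) : ℝ) := hn₁ n h1
    _ ≤ (3 * Real.logb 2 (Real.logb 2 N) + 5) * Real.logb 2 (Real.logb 2 N) / 2 *
          Real.logb 2 ((N : ℕ) : ℝ) := mul_le_mul_of_nonneg_right hcard hlogN
    _ ≤ n := hn₂ n h2

/-- **l.830–839 in the kernel** (typist-9's `averagingBound_of_parts`, re-targeted): the split, the
off-window bound `≤ 2n`, the window bound `≤ n` (for `n ≥ n₀`) and the odd half give `StepAvg` with one `n₀`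
(the maximum; "possibly larger than the former `n₀`"). [cite: Ri2025, §3 Step 2, l.830–839 (print p.13)] -/
theorem stepAvg_of_support (hoff : Step_avgOffWindow) (hwin : Step_avgWindow) (hodd : StepAvgOdd) :
    StepAvg := by
  obtain ⟨n₁, hn₁⟩ := hwin
  obtain ⟨n₂, hn₂⟩ := hodd
  refine ⟨max (max n₁ n₂) 1, fun n hn => ⟨?_, hn₂ n ?_⟩⟩
  · have h1 : 1 ≤ n := le_trans (le_max_right _ _) hn
    have hw := hn₁ n (le_trans (le_max_left _ _) (le_trans (le_max_left _ _) hn))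
    have ho := hoff n h1
    rw [sum_b_j₀_eq]
    linarith
  · exact le_trans (le_max_right _ _) (le_trans (le_max_left _ _) hn)

/-- **COMPOSITION AT DISPLAY GRAIN** (rev 2): Theorem 1.1 from the steps of `claim_of_steps` with THE
AVERAGING BOUND replaced by its displayed support — off-window bound (l.812–816), LEVEL-COUNT INEQUALITY
(l.817–821), growth line (l.822–826), odd half (l.834–839) — through `windowBound_of_support`,
`stepAvg_of_support` and `claim_of_steps`; Lemma 3.2 is now consumed. Pure logic.
[claim: Ri2025, status: under-review] -/
theorem claim_of_support_steps (h21i : Step_L21i) (h21ii : Step_L21ii) (h31 : Step_L31) (h32 : Step_L32)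
    (h215 : Step_215) (hoff : Step_avgOffWindow) (hlc : Step_avgLevelCount) (hgr : Step_avgGrowth)
    (hodd : StepAvgOdd) (h414 : Step_414n) (hcl : Step_close) (hT : Step_T) : ClaimedTheorem :=
  claim_of_steps h21i h21ii h31 h32 h215
    (stepAvg_of_support hoff
      (windowBound_of_support (stepAvgLevelCountEv_of_levelCount hlc) h32 hgr) hodd)
    h414 hcl hT

/-- The same composition from the EVENTUAL (charitable) level-count inequality. Pure logic.
[claim: Ri2025, status: under-review] -/
theorem claim_of_support_steps_ev (h21i : Step_L21i) (h21ii : Step_L21ii) (h31 : Step_L31)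
    (h32 : Step_L32) (h215 : Step_215) (hoff : Step_avgOffWindow) (hlc : Step_avgLevelCountEv)
    (hgr : Step_avgGrowth) (hodd : StepAvgOdd) (h414 : Step_414n) (hcl : Step_close) (hT : Step_T) :
    ClaimedTheorem :=
  claim_of_steps h21i h21ii h31 h32 h215
    (stepAvg_of_support hoff (windowBound_of_support hlc h32 hgr) hodd) h414 hcl hT

/-! ### API of the sequences used by the support steps (typist-9's texts) -/

/-- Window predicate of (2.2) (l.307–315): `j = i + 2^{2^k}`, `k ≥ 1`, `−k ≤ i ≤ k`. Text: typist-9.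
[cite: Ri2025, (2.2) l.307–315 (print p.5)] -/
def InWindowA (j : ℤ) : Prop :=
  ∃ k : ℕ, 1 ≤ k ∧ |j - 2 ^ (2 ^ k)| ≤ (k : ℤ)

/-- Off the windows of (2.2) the weight is `1`. Text: typist-9. [cite: Ri2025, (2.2) l.307–315 (print p.5)] -/
theorem a_of_not_inWindowA {j : ℤ} (h : ¬ InWindowA j) : a j = 1 := by
  unfold InWindowA at h
  unfold a
  exact if_neg h

/-- On the windows of (2.2) the weight is `log₂ j`. Text: typist-9. [cite: Ri2025, (2.2) l.307–315 (print p.5)] -/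
theorem a_of_inWindowA {j : ℤ} (h : InWindowA j) : a j = Real.logb 2 j := by
  unfold InWindowA at h
  unfold a
  exact if_pos h

/-- The recursion "`b(j+1) = ½(b(j) + a(j+1))` for all `j ∈ ℕ`" of the proof of Lemma 3.1 (l.543–544).
Text: typist-9. [cite: Ri2025, proof of Lemma 3.1, l.543–544 (print p.8)] -/
theorem b_succ (j : ℕ) : b (j + 1) = (b j + a ((j : ℤ) + 1)) / 2 := by
  unfold b
  rw [Finset.sum_Icc_succ_top (by omega : 1 ≤ j + 1)]
  push_cast
  field_simp
  ring

/-- `j₀(1) = 1`. Text: typist-9. [cite: Ri2025, (4.3) l.707–710 (print (3.8) p.11)] -/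
theorem j₀_one : j₀ 1 = 1 := by
  simp [j₀]

/-- `j₀(2^m) = m + 1` (so `j₀(2k) = ⌈log₂ k⌉ + 2` at `k = 2^{m−1}`, l.806). Text: typist-9.
[cite: Ri2025, (4.3) l.707–710 (print (3.8) p.11)] -/
theorem j₀_two_pow (m : ℕ) : j₀ (2 ^ m) = m + 1 := by
  simp [j₀, Nat.clog_pow]

/-! ## Discharged TRUE step: the growth line (l.822–826) (append-only; ns-claims D-0026 debt pass,
typist-9 g4)

The last inequality of the display l.817–829 — iterated logarithms of `⌈log₂n⌉ + 2` against `n` — is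
the elementary part of the chain (the level-count line before it is kernel-false Summits-side,
`Theorems.SoloRefuteRi2025LevelCount`). With `m = ⌈log₂ n⌉ + 2` and `log₂ y ≤ 2y` (`y > 0`):
`(3 log₂log₂ m + 5)(log₂log₂ m)/2 · log₂ m ≤ (12m + 5)(2m)(2m) ≤ 68m³`, and `68(p+3)³ ≤ 2^p < n` for
`p = ⌈log₂ n⌉ − 1 ≥ 20`. -/

/-- `log₂ y ≤ 2y` for `y > 0` (from `log y ≤ y − 1` and `log 2 > 0.69`). [folklore] -/
private theorem logb_two_le_two_mul {y : ℝ} (hy : 0 < y) : Real.logb 2 y ≤ 2 * y := by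
  have h1 : Real.log y ≤ y - 1 := Real.log_le_sub_one_of_pos hy
  have h2 : (0.6931471803 : ℝ) < Real.log 2 := Real.log_two_gt_d9
  rw [Real.logb, div_le_iff₀ (by linarith)]
  nlinarith

/-- `1 ≤ log₂ y` for `y ≥ 2`. [folklore] -/
private theorem one_le_logb_two {y : ℝ} (hy : 2 ≤ y) : 1 ≤ Real.logb 2 y := by
  have h : Real.logb 2 2 ≤ Real.logb 2 y :=
    Real.logb_le_logb_of_le (by norm_num) (by norm_num) hy
  rwa [Real.logb_self_eq_one (by norm_num)] at h

/-- The growth line's left side is at most `68 m³` at `m ≥ 2` (`m` standing for `⌈log₂ n⌉ + 2`).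
[cite: Ri2025, §3 Step 2, l.822–826 (print p.13)] -/
private theorem growth_lhs_le {m : ℝ} (hm : 2 ≤ m) :
    (3 * Real.logb 2 (Real.logb 2 m) + 5) * Real.logb 2 (Real.logb 2 m) / 2 * Real.logb 2 m ≤
      68 * m ^ 3 := by
  set Lm := Real.logb 2 m with hLm
  set LL := Real.logb 2 Lm with hLL
  have hm0 : 0 < m := by linarith
  have hLm1 : 1 ≤ Lm := one_le_logb_two hm
  have hLm0 : 0 < Lm := by linarith
  have hLm_le : Lm ≤ 2 * m := logb_two_le_two_mul hm0
  have hLL0 : 0 ≤ LL := Real.logb_nonneg (by norm_num) hLm1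
  have hLL_le : LL ≤ 2 * Lm := logb_two_le_two_mul hLm0
  have hA : 3 * LL + 5 ≤ 12 * m + 5 := by linarith
  have hB : LL / 2 ≤ 2 * m := by linarith
  have hAB : (3 * LL + 5) * (LL / 2) ≤ (12 * m + 5) * (2 * m) :=
    mul_le_mul hA hB (by positivity) (by positivity)
  have hABC : (3 * LL + 5) * (LL / 2) * Lm ≤ (12 * m + 5) * (2 * m) * (2 * m) :=
    mul_le_mul hAB hLm_le hLm0.le (by positivity)
  have heq : (3 * LL + 5) * LL / 2 * Lm = (3 * LL + 5) * (LL / 2) * Lm := by ring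
  rw [heq]
  have hm1 : 1 ≤ m := by linarith
  nlinarith [hABC, mul_nonneg (mul_nonneg hm0.le hm0.le) (by linarith : (0 : ℝ) ≤ m - 1)]

/-- `68 (p + 3)³ ≤ 2^p` for `p ≥ 20`. [folklore] -/
private theorem sixtyEight_mul_cube_le_two_pow {p : ℕ} (hp : 20 ≤ p) : 68 * (p + 3) ^ 3 ≤ 2 ^ p := by
  induction p, hp using Nat.le_induction with
  | base => norm_num
  | succ k hk ih =>
    have h1 : (k + 1 + 3) ^ 3 ≤ 2 * (k + 3) ^ 3 := by
      have hk3 : 1 ≤ k := by omega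
      nlinarith [hk3, Nat.zero_le k, pow_pos (show 0 < k by omega) 2]
    calc 68 * (k + 1 + 3) ^ 3 ≤ 68 * (2 * (k + 3) ^ 3) := Nat.mul_le_mul_left 68 h1
      _ = 2 * (68 * (k + 3) ^ 3) := by ring
      _ ≤ 2 * 2 ^ k := Nat.mul_le_mul_left 2 ih
      _ = 2 ^ (k + 1) := by rw [pow_succ]; ring

/-- **THE GROWTH LINE holds** (l.822–826, third and fourth lines of the display, print p.13):
there is `n₀` (here `2^20 + 1`) with `(3log₂log₂(⌈log₂n⌉+2)+5)/2 · log₂log₂(⌈log₂n⌉+2) ·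
log₂(⌈log₂n⌉+2) ≤ n` for all `n ≥ n₀` — the elementary eventual inequality (iterated logarithms
against `n`). Discharge of a TRUE step; the row's verdict (#8, the level-count line l.817–821, kernel-false
Summits-side) is untouched. [cite: Ri2025, §3 Step 2, l.822–826 (print p.13)] -/
theorem step_avgGrowth_holds : Step_avgGrowth := by
  refine ⟨1048577, fun n hn => ?_⟩
  -- `c = ⌈log₂ n⌉ ≥ 21` and `2^(c-1) < n`
  have hn1 : 1 < n := by omega
  have hle : n ≤ 2 ^ Nat.clog 2 n := Nat.le_pow_clog (by norm_num) n
  have hc21 : 21 ≤ Nat.clog 2 n := by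
    by_contra h
    have h' : Nat.clog 2 n ≤ 20 := by omega
    have h2 : 2 ^ Nat.clog 2 n ≤ 2 ^ 20 := Nat.pow_le_pow_right (by norm_num) h'
    have h20 : (2 : ℕ) ^ 20 = 1048576 := by norm_num
    omega
  have hlt : 2 ^ (Nat.clog 2 n - 1) < n := by
    have := Nat.pow_pred_clog_lt_self (b := 2) (by norm_num) hn1
    simpa [Nat.pred_eq_sub_one] using this
  obtain ⟨p, hp20, hcp⟩ : ∃ p : ℕ, 20 ≤ p ∧ Nat.clog 2 n = p + 1 :=
    ⟨Nat.clog 2 n - 1, by omega, by omega⟩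
  rw [hcp] at hlt
  simp only [Nat.add_sub_cancel] at hlt
  have key : 68 * (p + 3) ^ 3 < n := lt_of_le_of_lt (sixtyEight_mul_cube_le_two_pow hp20) hlt
  -- the real side
  have hm : ((Nat.clog 2 n + 2 : ℕ) : ℝ) = (p : ℝ) + 3 := by
    rw [hcp]; push_cast; ring
  rw [hm]
  have hm2 : (2 : ℝ) ≤ (p : ℝ) + 3 := by
    have : (0 : ℝ) ≤ p := Nat.cast_nonneg p
    linarith
  have hkeyR : (68 : ℝ) * ((p : ℝ) + 3) ^ 3 < n := by exact_mod_cast key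
  exact ((growth_lhs_le hm2).trans hkeyR.le)

/-! ## Discharged TRUE step: Lemma 3.2 (l.635–648) — the window-level count (append-only; ns-claims
D-0026 debt pass, typist-9 g4, second block)

`|S(n)| ≤ (3 log₂log₂ n + 5)(log₂log₂ n)/2` for every `n ≥ 1`, in the kernel. With `N_k = 2^{2^k}` and
`K = ⌊log₂⌊log₂ n⌋⌋` one has `N_K ≤ n < N_{K+1}`; the window levels `≤ n` lie in the full windows
`[N_k − k, N_k + 2k]`, `k ≤ K` (`3k+1` levels each, `Σ = (3K²+5K)/2`) plus at most `K+1` levels of the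
window `K+1`, the latter only when `n ≥ N_{K+1} − (K+1)`, where `log₂log₂ n ≥ K + 1/2`; otherwise
`log₂log₂ n ≥ K`. The bound is attained with equality at `n = N_k + 2k` for `k = 4, 5` (numerics in
the typist's notes), so the count of the partial window is exact. Lemma 3.2 precedes the row's locator
(the level-count line l.817–821, kernel-false Summits-side) in print order; this certificate backs the
«no earlier step fails» half of the verdict for Lemma 3.2. -/

/-- Window centre `N k = 2^{2^k}`. [cite: Ri2025, Lemma 3.2 l.635–648 (print p.10)] -/
private def winCentre (k : ℕ) : ℕ := 2 ^ (2 ^ k)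

/-- The extended window `[N_k − k, N_k + 2k]` of Lemma 3.1 / (4.1). [cite: Ri2025, Lemma 3.2 l.635–648 (print p.10)] -/
private def extWindow (k : ℕ) : Finset ℕ := Finset.Icc (winCentre k - k) (winCentre k + 2 * k)

/-- Helper for Lemma 3.2 (`k_lt_Nc`). [cite: Ri2025, Lemma 3.2 l.635–648 (print p.10)] -/
private theorem k_lt_Nc (k : ℕ) : k < winCentre k := by
  unfold winCentre
  calc k < 2 ^ k := Nat.lt_two_pow_self
    _ ≤ 2 ^ (2 ^ k) := Nat.pow_le_pow_right (by norm_num) Nat.lt_two_pow_self.le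

/-- Helper for Lemma 3.2 (`four_le_Nc`). [cite: Ri2025, Lemma 3.2 l.635–648 (print p.10)] -/
private theorem four_le_Nc {k : ℕ} (hk : 1 ≤ k) : 4 ≤ winCentre k := by
  unfold winCentre
  calc 4 = 2 ^ (2 ^ 1) := by norm_num
    _ ≤ 2 ^ (2 ^ k) := Nat.pow_le_pow_right (by norm_num) (Nat.pow_le_pow_right (by norm_num) hk)

/-- `k + 3 ≤ N_k` for `k ≥ 1`. [cite: Ri2025, Lemma 3.2 l.635–648 (print p.10)] -/
private theorem add_three_le_Nc {k : ℕ} (hk : 1 ≤ k) : k + 3 ≤ winCentre k := by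
  unfold winCentre
  have h1 : k + 3 ≤ 2 ^ (k + 1) := by
    induction k, hk using Nat.le_induction with
    | base => norm_num
    | succ m _ ih => rw [pow_succ]; omega
  have h2 : k + 1 ≤ 2 ^ k := Nat.lt_two_pow_self
  exact h1.trans (Nat.pow_le_pow_right (by norm_num) h2)

/-- Helper for Lemma 3.2 (`Nc_succ`). [cite: Ri2025, Lemma 3.2 l.635–648 (print p.10)] -/
private theorem Nc_succ (k : ℕ) : winCentre (k + 1) = winCentre k * winCentre k := by
  unfold winCentre; rw [pow_succ, pow_mul, sq]

/-- Helper for Lemma 3.2 (`two_le_Nc`). [cite: Ri2025, Lemma 3.2 l.635–648 (print p.10)] -/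
private theorem two_le_Nc (k : ℕ) : 2 ≤ winCentre k := by
  unfold winCentre
  calc 2 = 2 ^ 1 := by norm_num
    _ ≤ 2 ^ (2 ^ k) := Nat.pow_le_pow_right (by norm_num) Nat.one_le_two_pow

/-- `N_k − k` is monotone: `N_k − k + 1 ≤ N_{k+1} − (k+1)`. [cite: Ri2025, Lemma 3.2 l.635–648 (print p.10)] -/
private theorem Nc_sub_lt_succ (k : ℕ) : winCentre k - k + 1 ≤ winCentre (k + 1) - (k + 1) := by
  have h1 := k_lt_Nc k
  have h2 := two_le_Nc k
  have h3 : winCentre (k + 1) = winCentre k * winCentre k := Nc_succ k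
  have h4 : 2 * winCentre k ≤ winCentre k * winCentre k := Nat.mul_le_mul_right _ h2
  omega

/-- Helper for Lemma 3.2 (`Nc_sub_mono`). [cite: Ri2025, Lemma 3.2 l.635–648 (print p.10)] -/
private theorem Nc_sub_mono {k k' : ℕ} (h : k ≤ k') : winCentre k - k ≤ winCentre k' - k' := by
  induction k', h using Nat.le_induction with
  | base => exact le_rfl
  | succ m _ ih => exact ih.trans ((Nat.le_succ _).trans (Nc_sub_lt_succ m))

/-- `N_{K+1} ≤ N_{K+2} − (K+2)`. [cite: Ri2025, Lemma 3.2 l.635–648 (print p.10)] -/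
private theorem Nc_succ_le_sub (K : ℕ) : winCentre (K + 1) ≤ winCentre (K + 2) - (K + 2) := by
  have h1 := k_lt_Nc (K + 1)
  have h2 : 4 ≤ winCentre (K + 1) := four_le_Nc (by omega)
  have h3 : winCentre (K + 2) = winCentre (K + 1) * winCentre (K + 1) := Nc_succ (K + 1)
  have h4 : 4 * winCentre (K + 1) ≤ winCentre (K + 1) * winCentre (K + 1) := Nat.mul_le_mul_right _ h2
  omega

/-- Helper for Lemma 3.2 (`card_W`). [cite: Ri2025, Lemma 3.2 l.635–648 (print p.10)] -/
private theorem card_W (k : ℕ) : (extWindow k).card = 3 * k + 1 := by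
  unfold extWindow
  have := k_lt_Nc k
  rw [Nat.card_Icc]
  omega

/-- `2 Σ_{k=1}^{K} (3k+1) = 3K² + 5K`. [cite: Ri2025, Lemma 3.2 l.635–648 (print p.10)] -/
private theorem two_mul_sum_window (K : ℕ) :
    2 * ∑ k ∈ Finset.Icc 1 K, (3 * k + 1) = 3 * K ^ 2 + 5 * K := by
  induction K with
  | zero => simp
  | succ m ih =>
    rw [Finset.sum_Icc_succ_top (by omega), mul_add, ih]
    ring

/-- The level parameter `K(n) = ⌊log₂⌊log₂ n⌋⌋`. [cite: Ri2025, Lemma 3.2 l.635–648 (print p.10)] -/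
private def levelParam (n : ℕ) : ℕ := Nat.log 2 (Nat.log 2 n)

/-- Helper for Lemma 3.2 (`Nc_Kl_le`). [cite: Ri2025, Lemma 3.2 l.635–648 (print p.10)] -/
private theorem Nc_Kl_le {n : ℕ} (hn : 2 ≤ n) : winCentre (levelParam n) ≤ n := by
  unfold winCentre levelParam
  have h1 : 2 ^ Nat.log 2 (Nat.log 2 n) ≤ Nat.log 2 n :=
    Nat.pow_log_le_self 2 (by
      have : 1 ≤ Nat.log 2 n := Nat.le_log_of_pow_le (by norm_num) (by simpa using hn)
      omega)
  calc 2 ^ 2 ^ Nat.log 2 (Nat.log 2 n) ≤ 2 ^ Nat.log 2 n := Nat.pow_le_pow_right (by norm_num) h1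
    _ ≤ n := Nat.pow_log_le_self 2 (by omega)

/-- Helper for Lemma 3.2 (`lt_Nc_Kl_succ`). [cite: Ri2025, Lemma 3.2 l.635–648 (print p.10)] -/
private theorem lt_Nc_Kl_succ (n : ℕ) : n < winCentre (levelParam n + 1) := by
  unfold winCentre levelParam
  have h1 : n < 2 ^ (Nat.log 2 n + 1) := Nat.lt_pow_succ_log_self (by norm_num) n
  have h2 : Nat.log 2 n < 2 ^ (Nat.log 2 (Nat.log 2 n) + 1) :=
    Nat.lt_pow_succ_log_self (by norm_num) _
  calc n < 2 ^ (Nat.log 2 n + 1) := h1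
    _ ≤ 2 ^ 2 ^ (Nat.log 2 (Nat.log 2 n) + 1) := Nat.pow_le_pow_right (by norm_num) (by omega)

/-- Every window level `l ∈ S(n)` has window index `k ≤ K(n) + 1`. [cite: Ri2025, Lemma 3.2 l.635–648 (print p.10)] -/
private theorem S_subset (n : ℕ) :
    S n ⊆ (Finset.Icc 1 (levelParam n)).biUnion extWindow ∪
      Finset.Icc (winCentre (levelParam n + 1) - (levelParam n + 1)) (winCentre (levelParam n + 1) - 1) := by
  classical
  intro l hl
  unfold S at hl
  rw [Finset.mem_filter, Finset.mem_Icc] at hl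
  obtain ⟨⟨hl1, hln⟩, k, hk1, hkl, hlk⟩ := hl
  have hnlt := lt_Nc_Kl_succ n
  -- `k ≤ K + 1`
  have hkK : k ≤ levelParam n + 1 := by
    by_contra h
    have hk2 : levelParam n + 2 ≤ k := by omega
    have := Nc_sub_mono hk2
    have := Nc_succ_le_sub (levelParam n)
    change winCentre k - k ≤ l at hkl
    omega
  rw [Finset.mem_union]
  rcases Nat.lt_or_ge k (levelParam n + 1) with hlt | hge
  · left
    rw [Finset.mem_biUnion]
    refine ⟨k, Finset.mem_Icc.mpr ⟨hk1, by omega⟩, ?_⟩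
    unfold extWindow
    rw [Finset.mem_Icc]
    exact ⟨hkl, hlk⟩
  · right
    have hkeq : k = levelParam n + 1 := le_antisymm hkK hge
    subst hkeq
    rw [Finset.mem_Icc]
    change winCentre (levelParam n + 1) - (levelParam n + 1) ≤ l at hkl
    constructor
    · exact hkl
    · have : l < winCentre (levelParam n + 1) := lt_of_le_of_lt hln hnlt
      omega

/-- The counting bound: `2|S(n)| ≤ 3K² + 5K + 2·(partial)`, partial `≤ K+1` and `= 0` unless
`n ≥ N_{K+1} − (K+1)`. [cite: Ri2025, Lemma 3.2 l.635–648 (print p.10)] -/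
private theorem two_mul_card_S_le (n : ℕ) :
    2 * (S n).card ≤ 3 * levelParam n ^ 2 + 5 * levelParam n +
      2 * (if winCentre (levelParam n + 1) - (levelParam n + 1) ≤ n then levelParam n + 1 else 0) := by
  classical
  have hsub := S_subset n
  have hK1 := k_lt_Nc (levelParam n + 1)
  have hnlt := lt_Nc_Kl_succ n
  -- intersect the partial part with `Icc 1 n` is automatic from `S n ⊆ Icc 1 n`
  have hS_le_n : ∀ l ∈ S n, l ≤ n := by
    intro l hl
    unfold S at hl
    exact (Finset.mem_Icc.mp (Finset.mem_filter.mp hl).1).2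
  set P : Finset ℕ := Finset.Icc (winCentre (levelParam n + 1) - (levelParam n + 1)) (winCentre (levelParam n + 1) - 1) with hP
  have hcard1 : ((Finset.Icc 1 (levelParam n)).biUnion extWindow).card ≤ ∑ k ∈ Finset.Icc 1 (levelParam n), (3 * k + 1) := by
    refine (Finset.card_biUnion_le).trans ?_
    refine Finset.sum_le_sum fun k _ => ?_
    rw [card_W]
  by_cases hpart : winCentre (levelParam n + 1) - (levelParam n + 1) ≤ n
  · rw [if_pos hpart]
    have hcardP : P.card = levelParam n + 1 := by
      rw [hP, Nat.card_Icc]; omega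
    have h1 : (S n).card ≤ ((Finset.Icc 1 (levelParam n)).biUnion extWindow).card + P.card :=
      (Finset.card_le_card hsub).trans (Finset.card_union_le _ _)
    have h2 := two_mul_sum_window (levelParam n)
    omega
  · rw [if_neg hpart]
    -- no element of `S n` lies in `P`
    have hsub' : S n ⊆ (Finset.Icc 1 (levelParam n)).biUnion extWindow := by
      intro l hl
      have hl' := hsub hl
      rw [Finset.mem_union] at hl'
      rcases hl' with h | h
      · exact h
      · exfalso
        rw [hP, Finset.mem_Icc] at h
        have := hS_le_n l hl
        omega
    have h1 : (S n).card ≤ ((Finset.Icc 1 (levelParam n)).biUnion extWindow).card := Finset.card_le_card hsub'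
    have h2 := two_mul_sum_window (levelParam n)
    omega

/-! ### The iterated logarithm against the level parameter -/

/-- `2^x ≤ y ⇒ x ≤ log₂ y` packaging. [cite: Ri2025, Lemma 3.2 l.635–648 (print p.10)] -/
private theorem le_logb_two_of_rpow_le {x y : ℝ} (hy : 0 < y) (h : (2 : ℝ) ^ x ≤ y) : x ≤ Real.logb 2 y :=
  (Real.le_logb_iff_rpow_le (by norm_num) hy).mpr h

/-- For `n ≥ 2`: `log₂ n ≥ 2^{K(n)}` and hence `log₂ log₂ n ≥ K(n)`. [cite: Ri2025, Lemma 3.2 l.635–648 (print p.10)] -/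
private theorem Kl_le_loglog {n : ℕ} (hn : 2 ≤ n) : (levelParam n : ℝ) ≤ Real.logb 2 (Real.logb 2 n) := by
  have hn0 : (0 : ℝ) < n := by exact_mod_cast (show 0 < n by omega)
  have hn1 : (1 : ℝ) < n := by exact_mod_cast (show 1 < n by omega)
  have hN : ((winCentre (levelParam n) : ℕ) : ℝ) ≤ n := by exact_mod_cast Nc_Kl_le hn
  have hlog1 : ((2 ^ levelParam n : ℕ) : ℝ) ≤ Real.logb 2 n := by
    apply le_logb_two_of_rpow_le hn0
    rw [Real.rpow_natCast]
    have : ((2 : ℝ) ^ (2 ^ levelParam n)) = ((winCentre (levelParam n) : ℕ) : ℝ) := by unfold winCentre; push_cast; ring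
    rw [this]; exact hN
  have hpos : 0 < Real.logb 2 (n : ℝ) := Real.logb_pos (by norm_num) hn1
  apply le_logb_two_of_rpow_le hpos
  rw [Real.rpow_natCast]
  exact_mod_cast hlog1

/-- `√2 < 3/2`. [cite: Ri2025, Lemma 3.2 l.635–648 (print p.10)] -/
private theorem sqrt_two_lt_three_halves : Real.sqrt 2 < 3 / 2 := by
  rw [Real.sqrt_lt' (by norm_num)]; norm_num

/-- In the partial-window range `n ≥ N_{K+1} − (K+1)`: `log₂ log₂ n ≥ K + 1/2`. [cite: Ri2025, Lemma 3.2 l.635–648 (print p.10)] -/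
private theorem half_le_loglog {K n : ℕ} (hpart : winCentre (K + 1) - (K + 1) ≤ n) :
    (K : ℝ) + 1 / 2 ≤ Real.logb 2 (Real.logb 2 n) := by
  have hKN := k_lt_Nc (K + 1)
  have h4 : K + 1 + 3 ≤ winCentre (K + 1) := add_three_le_Nc (by omega)
  have hn3 : 3 ≤ n := by omega
  have hn0 : (0 : ℝ) < n := by exact_mod_cast (show 0 < n by omega)
  have hn1 : (1 : ℝ) < n := by exact_mod_cast (show 1 < n by omega)
  have hpos : 0 < Real.logb 2 (n : ℝ) := Real.logb_pos (by norm_num) hn1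
  have hs2 := sqrt_two_lt_three_halves
  have hs0 : 0 ≤ Real.sqrt 2 := Real.sqrt_nonneg 2
  -- `2^{K + 1/2} = 2^K √2`
  have hsplit : (2 : ℝ) ^ ((K : ℝ) + 1 / 2) = 2 ^ K * Real.sqrt 2 := by
    rw [Real.rpow_add (by norm_num), Real.rpow_natCast, Real.sqrt_eq_rpow]
  apply le_logb_two_of_rpow_le hpos
  rw [hsplit]
  rcases Nat.eq_zero_or_pos K with hK0 | hK1
  · -- `K = 0`: `√2 ≤ 3/2 ≤ log₂ 3 ≤ log₂ n`
    subst hK0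
    simp only [pow_zero, one_mul]
    have h3 : (3 : ℝ) / 2 ≤ Real.logb 2 (n : ℝ) := by
      apply le_logb_two_of_rpow_le hn0
      have hn3' : (3 : ℝ) ≤ n := by exact_mod_cast hn3
      have : (2 : ℝ) ^ ((3 : ℝ) / 2) = 2 * Real.sqrt 2 := by
        rw [show (3 : ℝ) / 2 = (1 : ℝ) + 1 / 2 by norm_num, Real.rpow_add (by norm_num),
          Real.rpow_one, Real.sqrt_eq_rpow]
      rw [this]
      nlinarith
    linarith
  · -- `K ≥ 1`: `2^K √2 ≤ 2^{K+1} − 1 ≤ log₂(N_{K+1}/2) ≤ log₂ n`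
    have h2K : (2 : ℝ) ≤ 2 ^ K := by
      calc (2 : ℝ) = 2 ^ 1 := by norm_num
        _ ≤ 2 ^ K := pow_le_pow_right₀ (by norm_num) hK1
    -- `m = 2^{K+1} − 1`, `2^m ≤ n`
    have hm1 : 1 ≤ 2 ^ (K + 1) := Nat.one_le_two_pow
    have hmlt : 2 ^ (K + 1) - 1 < 2 ^ (2 ^ (K + 1) - 1) := Nat.lt_two_pow_self
    have hNc : winCentre (K + 1) = 2 * 2 ^ (2 ^ (K + 1) - 1) := by
      unfold winCentre
      rw [← pow_succ']
      congr 1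
      omega
    have hKe : K < 2 ^ K := Nat.lt_two_pow_self
    have h2m_le : 2 ^ (2 ^ (K + 1) - 1) ≤ n := by
      have : 2 ^ (K + 1) = 2 * 2 ^ K := by rw [pow_succ']
      omega
    have hlog : ((2 : ℝ) ^ (K + 1) - 1) ≤ Real.logb 2 (n : ℝ) := by
      apply le_logb_two_of_rpow_le hn0
      have hcast : ((2 : ℝ) ^ (K + 1) - 1) = ((2 ^ (K + 1) - 1 : ℕ) : ℝ) := by
        rw [Nat.cast_sub hm1]; push_cast; ring
      rw [hcast, Real.rpow_natCast]
      exact_mod_cast h2m_le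
    have : (2 : ℝ) ^ K * Real.sqrt 2 ≤ 2 ^ (K + 1) - 1 := by
      rw [pow_succ]
      nlinarith
    linarith

/-! ### Assembly -/

/-- `S(1) = ∅`: every window level is `≥ 3`. [cite: Ri2025, (4.1) l.629–632 (print p.10)] -/
private theorem S_one_eq_empty : S 1 = ∅ := by
  classical
  apply Finset.eq_empty_of_forall_notMem
  intro l hl
  unfold S at hl
  rw [Finset.mem_filter, Finset.mem_Icc] at hl
  obtain ⟨⟨_, hl1⟩, k, hk1, hkl, _⟩ := hl
  have hmono := Nc_sub_mono hk1
  have h4 : winCentre 1 = 4 := by unfold winCentre; norm_num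
  change winCentre k - k ≤ l at hkl
  omega

/-- **LEMMA 3.2 holds** (l.635–641, proof l.642–648, print p.10): for every `n ≥ 1`,
`|S(n)| ≤ (3 log₂log₂ n + 5) log₂log₂ n / 2`, where `S(n)` = the window levels `l ≤ n`,
`−k + 2^{2^k} ≤ l ≤ 2^{2^k} + 2k` for some `k ≥ 1` ((4.1)). Kernel route: full windows `k ≤ K =
⌊log₂⌊log₂n⌋⌋` contribute `Σ_{k≤K}(3k+1) = (3K²+5K)/2 ≤ (3x+5)x/2` with `x = log₂log₂ n ≥ K`; a partial
window `K+1` contributes `≤ K+1` more and then `x ≥ K + 1/2`, `(3x+5)x/2 ≥ (3K²+8K+13/4)/2 ≥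
(3K²+7K+2)/2`; `n = 1`: `S(1) = ∅`. Discharge of a TRUE step preceding the row's locator; token #8
unchanged. [cite: Ri2025, Lemma 3.2 l.635–648 (print p.10)] -/
theorem step_L32_holds : Step_L32 := by
  classical
  intro n hn
  rcases Nat.lt_or_ge n 2 with hlt | hn2
  · have hn1 : n = 1 := by omega
    subst hn1
    simp [S_one_eq_empty]
  · have hc := two_mul_card_S_le n
    have hx := Kl_le_loglog hn2
    have hK0 : (0 : ℝ) ≤ (levelParam n : ℝ) := Nat.cast_nonneg _
    by_cases hpart : winCentre (levelParam n + 1) - (levelParam n + 1) ≤ n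
    · rw [if_pos hpart] at hc
      have hx' : (levelParam n : ℝ) + 1 / 2 ≤ Real.logb 2 (Real.logb 2 n) := half_le_loglog hpart
      have hcR : 2 * ((S n).card : ℝ) ≤ 3 * (levelParam n : ℝ) ^ 2 + 5 * (levelParam n : ℝ) + 2 * ((levelParam n : ℝ) + 1) := by
        exact_mod_cast hc
      have hx0 : 0 ≤ Real.logb 2 (Real.logb 2 n) := by linarith
      nlinarith [mul_nonneg (sub_nonneg.2 hx')
        (by linarith : (0 : ℝ) ≤ 3 * Real.logb 2 (Real.logb 2 n) + 3 * ((levelParam n : ℝ) + 1 / 2) + 5)]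
    · rw [if_neg hpart] at hc
      have hcR : 2 * ((S n).card : ℝ) ≤ 3 * (levelParam n : ℝ) ^ 2 + 5 * (levelParam n : ℝ) := by
        exact_mod_cast hc
      nlinarith [mul_nonneg (sub_nonneg.2 hx)
        (by linarith : (0 : ℝ) ≤ 3 * Real.logb 2 (Real.logb 2 n) + 3 * (levelParam n : ℝ) + 5)]


/-! ## Discharged TRUE step: Lemma 3.1 (l.522–540) — the averaged weight `b(j)` (append-only;
ns-claims D-0026 debt pass, typist-9 g4, third block)

In-window half: every summand has `a(i) ≤ max(1, log₂ i) ≤ log₂ j` (`j ≥ 2`) and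
`Σ_{i≤j} 2^i ≤ 2^{j+1}`, so `b(j) ≤ log₂ j`. Off-window half (the paper's recursion
`b(j+1) = ½(b(j) + a(j+1))`, l.541–625): with `K = ⌊log₂⌊log₂ j⌋⌋` an off-window `j ≥ 3` satisfies
`N_K + 2K < j < N_{K+1} − (K+1)`, the weights are `a ≡ 1` on `(N_K + K, j]`, hence
`b(j) = 1 + (b(N_K+K) − 1)/2^{j−N_K−K} ≤ 1 + 2^K/2^{K+1} = 3/2`; `j ≤ 2`: `b(j) ≤ 1`. -/

/-- `Σ_{i=1}^{j} 2^i ≤ 2^{j+1}`. [folklore] -/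
private theorem sum_two_pow_Icc_le (j : ℕ) : ∑ i ∈ Finset.Icc 1 j, (2 : ℝ) ^ i ≤ 2 ^ (j + 1) := by
  induction j with
  | zero => simp
  | succ m ih =>
    rw [Finset.sum_Icc_succ_top (by omega)]
    have h2 : (2 : ℝ) ^ (m + 1 + 1) = 2 ^ (m + 1) + 2 ^ (m + 1) := by ring
    linarith

/-- A uniform bound on the weights bounds the average: `a(i) ≤ L` (`L ≥ 0`) for `1 ≤ i ≤ j` gives
`b(j) ≤ L`. [cite: Ri2025, (3.2) l.526–529 (print p.8)] -/
private theorem b_le_of_a_le {j : ℕ} {L : ℝ} (hL : 0 ≤ L) (ha : ∀ i ∈ Finset.Icc 1 j, a i ≤ L) :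
    b j ≤ L := by
  unfold b
  have h2 : (0 : ℝ) < 2 ^ (j + 1) := by positivity
  rw [div_le_iff₀ h2]
  calc ∑ i ∈ Finset.Icc 1 j, (2 : ℝ) ^ i * a i
      ≤ ∑ i ∈ Finset.Icc 1 j, (2 : ℝ) ^ i * L :=
        Finset.sum_le_sum fun i hi => mul_le_mul_of_nonneg_left (ha i hi) (by positivity)
    _ = L * ∑ i ∈ Finset.Icc 1 j, (2 : ℝ) ^ i := by rw [Finset.mul_sum]; simp [mul_comm]
    _ ≤ L * 2 ^ (j + 1) := mul_le_mul_of_nonneg_left (sum_two_pow_Icc_le j) hL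

/-- Every weight is at most `log₂ j` for `1 ≤ i ≤ j`, `j ≥ 2` (`a(i) ∈ {1, log₂ i}`).
[cite: Ri2025, (2.2) l.307–315 (print p.5)] -/
private theorem a_le_logb {i j : ℕ} (hi : i ∈ Finset.Icc 1 j) (hj : 2 ≤ j) :
    a i ≤ Real.logb 2 j := by
  rw [Finset.mem_Icc] at hi
  have hj1 : (1 : ℝ) ≤ Real.logb 2 j := by
    have h : Real.logb 2 2 ≤ Real.logb 2 j :=
      Real.logb_le_logb_of_le (by norm_num) (by norm_num) (by exact_mod_cast hj)
    rwa [Real.logb_self_eq_one (by norm_num)] at h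
  by_cases hw : InWindowA i
  · rw [a_of_inWindowA hw]
    push_cast
    exact Real.logb_le_logb_of_le (by norm_num) (by exact_mod_cast hi.1) (by exact_mod_cast hi.2)
  · rw [a_of_not_inWindowA hw]
    exact hj1

/-- **Lemma 3.1, in-window half (and more): `b(j) ≤ log₂ j` for every `j ≥ 2`.**
[cite: Ri2025, Lemma 3.1 l.522–540 (print p.8)] -/
theorem b_le_logb_two {j : ℕ} (hj : 2 ≤ j) : b j ≤ Real.logb 2 j :=
  b_le_of_a_le (le_trans zero_le_one (by
    have h : Real.logb 2 2 ≤ Real.logb 2 j :=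
      Real.logb_le_logb_of_le (by norm_num) (by norm_num) (by exact_mod_cast hj)
    rwa [Real.logb_self_eq_one (by norm_num)] at h)) fun _ hi => a_le_logb hi hj

/-- Off the windows of (2.2) the weight is `1`: the gap `(N_K + K, N_{K+1} − (K+1))` between the
`a`-window of level `K` and that of level `K+1` carries no window. [cite: Ri2025, (2.2) l.307–315 (print p.5)] -/
private theorem a_eq_one_of_gap {K i : ℕ} (h1 : winCentre K + K < i)
    (h2 : i < winCentre (K + 1) - (K + 1)) : a i = 1 := by
  apply a_of_not_inWindowA
  rintro ⟨k, hk1, hk⟩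
  have hcast : ((2 : ℤ) ^ (2 ^ k)) = ((winCentre k : ℕ) : ℤ) := by unfold winCentre; push_cast; ring
  rw [hcast, abs_le] at hk
  have hkN := k_lt_Nc k
  rcases Nat.lt_or_ge k (K + 1) with hlt | hge
  · -- `k ≤ K`: `N_k + k ≤ N_K + K < i`
    have hmono : winCentre k + k ≤ winCentre K + K := by
      have h' : k ≤ K := by omega
      have := Nc_sub_mono h'
      have hm : winCentre k ≤ winCentre K :=
        Nat.pow_le_pow_right (by norm_num) (Nat.pow_le_pow_right (by norm_num) h')
      omega
    omega
  · -- `k ≥ K+1`: `N_k − k ≥ N_{K+1} − (K+1) > i`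
    have hmono : winCentre (K + 1) - (K + 1) ≤ winCentre k - k := Nc_sub_mono hge
    omega

/-- The first two weights are `1` (`1, 2` lie below every window, `N_k − k ≥ 3`).
[cite: Ri2025, (2.2) l.307–315 (print p.5)] -/
private theorem a_eq_one_of_le_two {i : ℕ} (hi : i ≤ 2) : a i = 1 := by
  apply a_of_not_inWindowA
  rintro ⟨k, hk1, hk⟩
  have hcast : ((2 : ℤ) ^ (2 ^ k)) = ((winCentre k : ℕ) : ℤ) := by unfold winCentre; push_cast; ring
  rw [hcast, abs_le] at hk
  have h3 := add_three_le_Nc hk1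
  omega

/-- The recursion run along a window-free stretch: if `a ≡ 1` on `(J, J + m]` then
`b(J + m) = 1 + (b(J) − 1)/2^m`. [cite: Ri2025, proof of Lemma 3.1, l.541–625 (print p.8–9)] -/
private theorem b_stretch (J : ℕ) :
    ∀ m : ℕ, (∀ i : ℕ, J < i → i ≤ J + m → a i = 1) → b (J + m) = 1 + (b J - 1) / 2 ^ m := by
  intro m
  induction m with
  | zero => intro _; simp
  | succ n ih =>
    intro hgap
    have ih' := ih fun i hi1 hi2 => hgap i hi1 (by omega)
    have hlast : a (((J + n : ℕ) : ℤ) + 1) = 1 := by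
      have := hgap (J + n + 1) (by omega) (by omega)
      push_cast at this ⊢
      exact this
    rw [show J + (n + 1) = (J + n) + 1 by omega, b_succ, ih', hlast, pow_succ]
    field_simp
    ring

/-- `b(N_K + K) ≤ 2^K + 1` (`= log₂(2N_K)`), from the in-window half at `j = N_K + K ≤ 2N_K`.
[cite: Ri2025, Lemma 3.1 l.522–540 (print p.8)] -/
private theorem b_winEnd_le (K : ℕ) : b (winCentre K + K) ≤ 2 ^ K + 1 := by
  have hKN := k_lt_Nc K
  have h2 := two_le_Nc K
  have hj : 2 ≤ winCentre K + K := by omega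
  refine (b_le_logb_two hj).trans ?_
  rw [Real.logb_le_iff_le_rpow (by norm_num) (by exact_mod_cast (show 0 < winCentre K + K by omega))]
  have : (2 : ℝ) ^ ((2 : ℝ) ^ K + 1) = ((2 * winCentre K : ℕ) : ℝ) := by
    have h : (2 : ℝ) ^ K + 1 = ((2 ^ K + 1 : ℕ) : ℝ) := by push_cast; ring
    rw [h, Real.rpow_natCast]
    unfold winCentre; push_cast; ring
  rw [this]
  exact_mod_cast (show winCentre K + K ≤ 2 * winCentre K by omega)

/-- **LEMMA 3.1 holds** (l.522–540, proof l.541–625, print pp.8–9): for all `j ≥ 1`,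
`b(j) ≤ log₂ j` on the extended windows `−k + 2^{2^k} ≤ j ≤ 2^{2^k} + 2k` and `b(j) ≤ 2` off them.
Kernel route: in-window by the uniform weight bound (`b_le_logb_two`, valid for all `j ≥ 2`);
off-window by the recursion along the window-free stretch `(N_K + K, j]`, `K = ⌊log₂⌊log₂ j⌋⌋`:
`b(j) = 1 + (b(N_K+K) − 1)/2^{j−N_K−K} ≤ 1 + 2^K/2^{K+1} = 3/2` (`j ≤ 2`: `b ≤ 1`). Discharge of a
TRUE step preceding the row's locator; token #8 unchanged. [cite: Ri2025, Lemma 3.1 l.522–540 (print p.8)] -/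
theorem step_L31_holds : Step_L31 := by
  intro j hj
  refine ⟨fun hw => ?_, fun hnw => ?_⟩
  · -- in-window: `j ≥ N_k − k ≥ 3`
    obtain ⟨k, hk1, hkj, _⟩ := hw
    have hmono := Nc_sub_mono hk1
    have h4 : winCentre 1 = 4 := by unfold winCentre; norm_num
    change winCentre k - k ≤ j at hkj
    exact b_le_logb_two (by omega)
  · -- off-window
    rcases Nat.lt_or_ge j 3 with hj3 | hj3
    · -- `j ∈ {1, 2}`: all weights are `1`
      refine (b_le_of_a_le zero_le_one fun i hi => ?_).trans (by norm_num)
      rw [Finset.mem_Icc] at hi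
      rw [a_eq_one_of_le_two (by omega)]
    · -- `j ≥ 3`: level `K ≥ 1`, `N_K + 2K < j < N_{K+1} − (K+1)`
      set K := levelParam j with hKdef
      have hNK : winCentre K ≤ j := Nc_Kl_le (by omega)
      have hjlt : j < winCentre (K + 1) := lt_Nc_Kl_succ j
      have hKN := k_lt_Nc K
      have hK1N := k_lt_Nc (K + 1)
      have h4 : winCentre 1 = 4 := by unfold winCentre; norm_num
      have hK1 : 1 ≤ K := by
        by_contra h
        have hK0 : K = 0 := by omega
        rw [hK0, zero_add] at hjlt
        -- then `j = 3`, which lies in the extended window `k = 1`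
        exact hnw ⟨1, le_rfl, by change winCentre 1 - 1 ≤ j; omega,
          by change j ≤ winCentre 1 + 2 * 1; omega⟩
      have hlow : winCentre K + 2 * K < j := by
        by_contra h
        exact hnw ⟨K, hK1, by change winCentre K - K ≤ j; omega,
          by change j ≤ winCentre K + 2 * K; omega⟩
      have hhigh : j < winCentre (K + 1) - (K + 1) := by
        by_contra h
        exact hnw ⟨K + 1, by omega, by change winCentre (K + 1) - (K + 1) ≤ j; omega,
          by change j ≤ winCentre (K + 1) + 2 * (K + 1); omega⟩
      -- the window-free stretch
      obtain ⟨m, hm⟩ : ∃ m : ℕ, j = winCentre K + K + m := ⟨j - (winCentre K + K), by omega⟩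
      have hmK : K + 1 ≤ m := by omega
      have hgap : ∀ i : ℕ, winCentre K + K < i → i ≤ winCentre K + K + m → a i = 1 :=
        fun i hi1 hi2 => a_eq_one_of_gap hi1 (by omega)
      rw [hm, b_stretch (winCentre K + K) m hgap]
      have hbJ := b_winEnd_le K
      have h2m : (0 : ℝ) < 2 ^ m := by positivity
      have h2K1 : (2 : ℝ) ^ (K + 1) ≤ 2 ^ m := pow_le_pow_right₀ (by norm_num) hmK
      have hstep1 : (b (winCentre K + K) - 1) / 2 ^ m ≤ 2 ^ K / 2 ^ m :=
        div_le_div_of_nonneg_right (by linarith) h2m.le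
      have hstep2 : (2 : ℝ) ^ K / 2 ^ m ≤ 2 ^ K / 2 ^ (K + 1) :=
        div_le_div_of_nonneg_left (by positivity) (by positivity) h2K1
      have hstep3 : (2 : ℝ) ^ K / 2 ^ (K + 1) = 1 / 2 := by
        rw [pow_succ]; field_simp
      linarith

/-! ## Discharged TRUE step: the off-window bound (l.812–816) (append-only; ns-claims D-0026 debt
pass, typist-9 g4, fourth block)

«by Lemma 3.1, `Σ_{k≤n, j₀(2k)∉S(⌈log₂n⌉+2)} b(j₀(2k)) ≤ 2n`»: every summand is an off-window level
`l = j₀(2k) ≤ ⌈log₂ n⌉ + 2` (so `l ∉ S` means `l` is in no window), hence `b(l) ≤ 2` by Lemma 3.1, and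
there are at most `n` summands. -/

/-- `j₀(2k) ≤ ⌈log₂ n⌉ + 2` for `1 ≤ k ≤ n`. [cite: Ri2025, (4.3) l.707–710; §3 Step 2 l.806–811 (print p.12)] -/
private theorem j₀_two_mul_le {k n : ℕ} (hk : k ∈ Finset.Icc 1 n) : j₀ (2 * k) ≤ Nat.clog 2 n + 2 := by
  rw [Finset.mem_Icc] at hk
  unfold j₀
  have hle : n ≤ 2 ^ Nat.clog 2 n := Nat.le_pow_clog (by norm_num) n
  have h2k : 2 * k ≤ 2 ^ (Nat.clog 2 n + 1) := by rw [pow_succ]; omega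
  have := Nat.clog_le_of_le_pow h2k
  omega

/-- **THE OFF-WINDOW BOUND holds** (l.812–816, print p.12): for every `n ≥ 1`,
`Σ_{k≤n, j₀(2k)∉S(⌈log₂n⌉+2)} b(j₀(2k)) ≤ 2n` — each summand is `≤ 2` by Lemma 3.1 (`step_L31_holds`,
off-window half; the level `j₀(2k)` lies below `⌈log₂n⌉ + 2`, so «`∉ S`» means «in no window»), and
there are at most `n` summands. Discharge of a TRUE step preceding the locator; token #8 unchanged.
[cite: Ri2025, §3 Step 2, l.812–816 (print p.12)] -/
theorem step_avgOffWindow_holds : Step_avgOffWindow := by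
  classical
  intro n hn
  unfold offWindowSum
  set F := (Finset.Icc 1 n).filter (fun k => j₀ (2 * k) ∉ S (Nat.clog 2 n + 2)) with hF
  have hterm : ∀ k ∈ F, b (j₀ (2 * k)) ≤ 2 := by
    intro k hk
    rw [hF, Finset.mem_filter] at hk
    obtain ⟨hkn, hnot⟩ := hk
    have hl1 : 1 ≤ j₀ (2 * k) := by unfold j₀; omega
    have hlN : j₀ (2 * k) ≤ Nat.clog 2 n + 2 := j₀_two_mul_le hkn
    refine (step_L31_holds (j₀ (2 * k)) hl1).2 ?_
    intro hw
    apply hnot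
    unfold S
    rw [Finset.mem_filter, Finset.mem_Icc]
    exact ⟨⟨hl1, hlN⟩, hw⟩
  calc ∑ k ∈ F, b (j₀ (2 * k)) ≤ ∑ k ∈ F, (2 : ℝ) := Finset.sum_le_sum hterm
    _ = 2 * (F.card : ℝ) := by rw [Finset.sum_const, nsmul_eq_mul, mul_comm]
    _ ≤ 2 * (n : ℝ) := by
        have hc : F.card ≤ n := by
          rw [hF]
          exact (Finset.card_filter_le _ _).trans (by simp)
        have : (F.card : ℝ) ≤ n := by exact_mod_cast hc
        linarith

/-- `Step_avgOffWindow` — `_holds` alias of `step_avgOffWindow_holds` above under the fact's exact name (appended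
2026-08-28, D-0026 bookkeeping: the proof term is the existing theorem of this file; no statement,
definition or attribute is edited; no new named fact; the ledger's debt table listed the fact
unproved). [cite: Ri2025, §3 Step 2, l.812–816 (print p.12)] -/
theorem _root_.Literature.Claims.NS.Ri2025.Step_avgOffWindow_holds : Step_avgOffWindow :=
  _root_.Literature.Claims.NS.Ri2025.step_avgOffWindow_holds


/-! ## D-0026 in-file discharge — Lemma 2.1 (i) (typist-9 g4, APPEND-ONLY fifth block)

`step_L21i_holds : Step_L21i` — the rescaling smallness l.336–352 (proof l.361–484, print pp.5–7),
following the printed proof: under `λ = 2^m` the sharp dyadic blocks shift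
(`‖Δ_j(λv(λ·))‖₂² = λ⁻¹‖Δ_{j−m}v‖₂²`, from the `L²` Fourier dilation identity, tree
`coeFn_fourier_toLp_comp_smul`), so `‖λv(λ·)‖²_{X₁} = Σ_i 2^i a(i+m)⁻² ‖Δ_i v‖₂²`; for
`m = 2^{2^l}` the weights are `a(i+m) = log₂(i+m) ≥ l` on `|i| ≤ l` ((2.2)) and `≥ 1` elsewhere,
and `Σ_i 2^i‖Δ_i v‖₂² ≤ 2‖v‖²_{Ḣ^{1/2}} < ∞` (tree `MemHomSobolev`), whence a head/tail split.
Two imports are added (`FourierSobolevNormScalingProofs`, `HomSobolevInterpolation`). No statement /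
def / locator / class above is touched; Lemma 2.1 (ii) (`Step_L21ii`) and (2.15) are not addressed.

WHAT THIS IS NOT: not a claim about NS regularity or blow-up; not a claim about any author beyond
the typed locator. -/

/-- The sharp dyadic shell `2^{j-1} ≤ |ξ| < 2^j` of (2.1)/(2.3). [cite: Ri2025, §2 l.288–291] -/
private def shell (j : ℤ) : Set E3 := {ξ | (2 : ℝ) ^ (j - 1) ≤ ‖ξ‖ ∧ ‖ξ‖ < (2 : ℝ) ^ j}

/-- `dyadicSq` is the Fourier energy on the shell. [cite: Ri2025, §2 l.288–291] -/
private theorem dyadicSq_eq (v : E3 → C3) (j : ℤ) : dyadicSq v j = fourierEnergyOn v (shell j) 0 := rfl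

/-- Dyadic shells are measurable. [folklore] -/
private theorem measurableSet_shell (j : ℤ) : MeasurableSet (shell j) :=
  (measurableSet_le measurable_const measurable_norm).inter
    (measurableSet_lt measurable_norm measurable_const)

/-- `cplx (λv(λ·)) = λ • (cplx v)(λ·)`. [folklore] -/
private theorem cplx_nsRescaleData (c : ℝ) (v : E3 → E3) :
    cplx (nsRescaleData c v) = fun x => c • cplx v (c • x) := by
  funext x
  simp only [cplx, nsRescaleData, map_smul]

/-- `dim ℝ³ = 3`. [folklore] -/
private theorem finrank_E3 : Module.finrank ℝ E3 = 3 := by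
  simp [E3]

/-- Dilation of the Fourier energy on a set (weight `s = 0`): for `c > 0` and `w ∈ L²`,
`∫_A |𝓕(c w(c·))|² = c⁻¹ ∫_{c⁻¹A} |𝓕 w|²` on `ℝ³` (BCD 2011 §1.2, dilations).
[cite: Ri2025, proof of Lemma 2.1 (i), l.361–484 (print pp.5–7)] -/
private theorem fourierEnergyOn_rescale {w : E3 → C3} (hw : MemLp w 2 (volume : Measure E3))
    {c : ℝ} (hc : 0 < c) {A : Set E3} (hA : MeasurableSet A) :
    fourierEnergyOn (fun x => c • w (c • x)) A 0 =
      ENNReal.ofReal c⁻¹ * fourierEnergyOn w {η | c • η ∈ A} 0 := by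
  have hg : MemLp (fun x => w (c • x)) 2 (volume : Measure E3) := memLp_comp_smul_fun hw hc.ne'
  have hwc : MemLp (fun x => c • w (c • x)) 2 (volume : Measure E3) := hg.const_smul c
  have hB : MeasurableSet {η : E3 | c • η ∈ A} := hA.preimage (measurable_const_smul c)
  unfold fourierEnergyOn
  rw [dif_pos hwc, dif_pos hw]
  simp only [mul_zero, ENNReal.rpow_zero, one_mul]
  -- the `L²` class of `c • w(c·)` is `c •` the class of `w(c·)`
  have hLp : hwc.toLp (fun x => c • w (c • x)) = (c : ℂ) • hg.toLp (fun x => w (c • x)) := by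
    have e : (c : ℂ) • hg.toLp (fun x => w (c • x)) = c • hg.toLp (fun x => w (c • x)) := by
      rw [← Complex.coe_algebraMap, algebraMap_smul]
    rw [e]
    rfl
  have hF : ⇑(𝓕 (hwc.toLp (fun x => c • w (c • x))) : Lp C3 2 (volume : Measure E3)) =ᵐ[volume]
      fun ξ => c • (|(c ^ Module.finrank ℝ E3)⁻¹| •
        (𝓕 (hw.toLp w) : Lp C3 2 (volume : Measure E3)) (c⁻¹ • ξ)) := by
    rw [hLp, fourier_smul]
    filter_upwards [Lp.coeFn_smul (c : ℂ)
        (𝓕 (hg.toLp (fun x => w (c • x))) : Lp C3 2 (volume : Measure E3)),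
      coeFn_fourier_toLp_comp_smul hw hc.ne'] with ξ h1 h2
    rw [h1, Pi.smul_apply, h2, ← Complex.coe_algebraMap, algebraMap_smul]
  have hI : ∫⁻ ξ in A, ‖(𝓕 (hwc.toLp (fun x => c • w (c • x))) : Lp C3 2 (volume : Measure E3)) ξ‖ₑ ^ 2
      = ∫⁻ ξ in A, ENNReal.ofReal (c ^ 2 * ((c ^ 3)⁻¹) ^ 2) *
          ‖(𝓕 (hw.toLp w) : Lp C3 2 (volume : Measure E3)) (c⁻¹ • ξ)‖ₑ ^ 2 := by
    apply setLIntegral_congr_fun_ae hA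
    filter_upwards [hF] with ξ hξ _
    rw [hξ, enorm_smul, enorm_smul, finrank_E3, Real.enorm_eq_ofReal hc.le,
      Real.enorm_eq_ofReal (abs_nonneg _), abs_of_pos (by positivity),
      ENNReal.ofReal_mul (by positivity), ENNReal.ofReal_pow hc.le, ENNReal.ofReal_pow (by positivity)]
    ring
  rw [hI, lintegral_const_mul' _ _ ENNReal.ofReal_ne_top]
  -- change of variables `ξ = c • η` in the set integral
  have hset : A = (fun ξ : E3 => c⁻¹ • ξ) ⁻¹' {η : E3 | c • η ∈ A} := by
    ext ξ
    simp [smul_smul, mul_inv_cancel₀ hc.ne']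
  have hJ : ∫⁻ ξ in A, ‖(𝓕 (hw.toLp w) : Lp C3 2 (volume : Measure E3)) (c⁻¹ • ξ)‖ₑ ^ 2
      = ENNReal.ofReal (c ^ 3) *
        ∫⁻ η in {η : E3 | c • η ∈ A}, ‖(𝓕 (hw.toLp w) : Lp C3 2 (volume : Measure E3)) η‖ₑ ^ 2 := by
    rw [← lintegral_indicator hA, ← lintegral_indicator hB]
    have hind : (A.indicator fun ξ => ‖(𝓕 (hw.toLp w) : Lp C3 2 (volume : Measure E3)) (c⁻¹ • ξ)‖ₑ ^ 2)
        = fun ξ => ({η : E3 | c • η ∈ A}.indicator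
            (fun η => ‖(𝓕 (hw.toLp w) : Lp C3 2 (volume : Measure E3)) η‖ₑ ^ 2)) (c⁻¹ • ξ) := by
      funext ξ
      conv_lhs => rw [hset]
      exact Set.indicator_comp_right (fun ξ : E3 => c⁻¹ • ξ)
        (g := fun η => ‖(𝓕 (hw.toLp w) : Lp C3 2 (volume : Measure E3)) η‖ₑ ^ 2) (x := ξ)
    rw [hind, lintegral_comp_smul volume _ (inv_ne_zero hc.ne'), finrank_E3, inv_pow, inv_inv,
      abs_of_pos (by positivity)]
  rw [hJ, ← mul_assoc, ← ENNReal.ofReal_mul (by positivity)]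
  congr 2
  field_simp

/-- Rescaling by `2^m` shifts the dyadic shells by `m`. [cite: Ri2025, proof of Lemma 2.1 (i), l.361–484] -/
private theorem shell_rescale (m : ℕ) (j : ℤ) :
    {η : E3 | ((2 : ℝ) ^ m) • η ∈ shell j} = shell (j - m) := by
  have h2m : (0 : ℝ) < (2 : ℝ) ^ m := by positivity
  ext η
  simp only [shell, Set.mem_setOf_eq, norm_smul, Real.norm_eq_abs, abs_of_pos h2m]
  have e1 : (2 : ℝ) ^ (j - (m : ℤ) - 1) = (2 : ℝ) ^ (j - 1) / (2 : ℝ) ^ m := by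
    rw [show j - (m : ℤ) - 1 = (j - 1) - (m : ℤ) by ring, zpow_sub₀ (by norm_num), zpow_natCast]
  have e2 : (2 : ℝ) ^ (j - (m : ℤ)) = (2 : ℝ) ^ j / (2 : ℝ) ^ m := by
    rw [zpow_sub₀ (by norm_num), zpow_natCast]
  rw [e1, e2, div_le_iff₀ h2m, lt_div_iff₀ h2m, mul_comm]

/-- `‖Δ_j (λw(λ·))‖₂² = λ⁻¹ ‖Δ_{j−m} w‖₂²` for `λ = 2^m`, `w ∈ L²(ℝ³)`.
[cite: Ri2025, proof of Lemma 2.1 (i), l.361–484] -/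
private theorem dyadicSq_rescale {w : E3 → C3} (hw : MemLp w 2 (volume : Measure E3)) (m : ℕ) (j : ℤ) :
    dyadicSq (fun x => ((2 : ℝ) ^ m) • w (((2 : ℝ) ^ m) • x)) j =
      ENNReal.ofReal (((2 : ℝ) ^ m)⁻¹) * dyadicSq w (j - m) := by
  rw [dyadicSq_eq, dyadicSq_eq, fourierEnergyOn_rescale hw (by positivity) (measurableSet_shell j),
    shell_rescale]

/-- Two dyadic shells containing a common point coincide. [folklore] -/
private theorem shell_unique {ξ : E3} {j j' : ℤ} (hj : ξ ∈ shell j) (hj' : ξ ∈ shell j') : j = j' := by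
  simp only [shell, Set.mem_setOf_eq] at hj hj'
  have h1 : (2 : ℝ) ^ (j - 1) < (2 : ℝ) ^ j' := hj.1.trans_lt hj'.2
  have h2 : (2 : ℝ) ^ (j' - 1) < (2 : ℝ) ^ j := hj'.1.trans_lt hj.2
  rw [zpow_lt_zpow_iff_right₀ (by norm_num : (1 : ℝ) < 2)] at h1 h2
  omega

/-- The square of the `X₁` norm (the weighted `ℓ²` sum inside (2.3)). [cite: Ri2025, (2.3) l.316–326] -/
private def X1Sq (v : E3 → C3) : ℝ≥0∞ :=
  ∑' j : ℤ, ENNReal.ofReal ((2 : ℝ) ^ j / a j ^ 2) * dyadicSq v j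

/-- `‖v‖_{X₁} = (X1Sq v)^{1/2}`. [cite: Ri2025, (2.3) l.316–326] -/
private theorem eX1Norm_eq (v : E3 → C3) : eX1Norm v = X1Sq v ^ (1 / 2 : ℝ) := rfl

/-- `‖λw(λ·)‖²_{X₁} = Σ_i 2^i a(i+m)⁻² ‖Δ_i w‖₂²` for `λ = 2^m` (shift of the `ℓ²` index).
[cite: Ri2025, proof of Lemma 2.1 (i), l.361–484] -/
private theorem X1Sq_rescale {w : E3 → C3} (hw : MemLp w 2 (volume : Measure E3)) (m : ℕ) :
    X1Sq (fun x => ((2 : ℝ) ^ m) • w (((2 : ℝ) ^ m) • x)) =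
      ∑' i : ℤ, ENNReal.ofReal ((2 : ℝ) ^ i / a (i + m) ^ 2) * dyadicSq w i := by
  unfold X1Sq
  simp_rw [dyadicSq_rescale hw m]
  rw [← (Equiv.addRight (m : ℤ)).tsum_eq]
  refine tsum_congr fun i => ?_
  simp only [Equiv.coe_addRight, add_sub_cancel_right]
  rw [← mul_assoc, ← ENNReal.ofReal_mul (by positivity)]
  congr 2
  rw [zpow_add₀ (by norm_num : (2 : ℝ) ≠ 0), zpow_natCast, div_mul_eq_mul_div,
    mul_inv_cancel_right₀ (by positivity)]

/-- `a ≥ 1` everywhere (on a window `j ≥ 2^{2^k} − k ≥ 2`, so `log₂ j ≥ 1`). [cite: Ri2025, (2.2) l.307–315] -/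
private theorem one_le_a (j : ℤ) : 1 ≤ a j := by
  by_cases h : InWindowA j
  · rw [a_of_inWindowA h]
    obtain ⟨k, hk, hjk⟩ := h
    have h1 : k < 2 ^ k := Nat.lt_two_pow_self
    have h2 : 2 ^ k < 2 ^ (2 ^ k) := Nat.pow_lt_pow_right (by norm_num) h1
    have h3 : ((k : ℕ) : ℤ) + 2 ≤ 2 ^ (2 ^ k) := by exact_mod_cast (show k + 2 ≤ 2 ^ (2 ^ k) by omega)
    have hj : (2 : ℤ) ≤ j := by
      have := (abs_le.1 hjk).1
      omega
    exact one_le_logb_two (by exact_mod_cast hj)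
  · rw [a_of_not_inWindowA h]

/-- On the shifted window: `a(i + 2^{2^l}) = log₂(i + 2^{2^l}) ≥ l` for `|i| ≤ l`, `l ≥ 1`.
[cite: Ri2025, (2.2) l.307–315; proof of Lemma 2.1 (i), l.361–484] -/
private theorem le_a_shift {l : ℕ} (hl : 1 ≤ l) {i : ℤ} (hi : |i| ≤ l) :
    (l : ℝ) ≤ a (i + ((2 ^ (2 ^ l) : ℕ) : ℤ)) := by
  have hin : InWindowA (i + ((2 ^ (2 ^ l) : ℕ) : ℤ)) := ⟨l, hl, by push_cast; simpa using hi⟩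
  rw [a_of_inWindowA hin]
  have hPn : l < 2 ^ l := Nat.lt_two_pow_self
  have hP : (l : ℤ) < 2 ^ l := by exact_mod_cast hPn
  have hQ : 2 * (2 : ℤ) ^ l ≤ 2 ^ (2 ^ l) := by
    have h : 2 ^ (l + 1) ≤ 2 ^ (2 ^ l) := Nat.pow_le_pow_right (by norm_num) (by omega)
    have h' : ((2 ^ (l + 1) : ℕ) : ℤ) ≤ ((2 ^ (2 ^ l) : ℕ) : ℤ) := by exact_mod_cast h
    push_cast [pow_succ] at h'
    linarith
  have hi' : -(l : ℤ) ≤ i := (abs_le.1 hi).1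
  have h1 : (2 : ℤ) ^ l ≤ i + ((2 ^ (2 ^ l) : ℕ) : ℤ) := by
    push_cast
    omega
  have h1' : (2 : ℝ) ^ (l : ℝ) ≤ ((i + ((2 ^ (2 ^ l) : ℕ) : ℤ) : ℤ) : ℝ) := by
    rw [Real.rpow_natCast]
    exact_mod_cast h1
  exact le_logb_two_of_rpow_le (lt_of_lt_of_le (by positivity) h1') h1'

/-- On the window `|i| ≤ l` the shifted coefficient is at most `2^i / l²`.
[cite: Ri2025, proof of Lemma 2.1 (i), l.361–484] -/
private theorem coeff_le_window {l : ℕ} (hl : 1 ≤ l) {i : ℤ} (hi : |i| ≤ l) :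
    ENNReal.ofReal ((2 : ℝ) ^ i / a (i + ((2 ^ (2 ^ l) : ℕ) : ℤ)) ^ 2) ≤
      ENNReal.ofReal (((l : ℝ) ^ 2)⁻¹) * ENNReal.ofReal ((2 : ℝ) ^ i) := by
  rw [← ENNReal.ofReal_mul (by positivity)]
  apply ENNReal.ofReal_le_ofReal
  rw [div_eq_mul_inv, mul_comm]
  apply mul_le_mul_of_nonneg_right _ (by positivity)
  have hl' : (0 : ℝ) < l := by exact_mod_cast hl
  exact inv_anti₀ (by positivity) (pow_le_pow_left₀ hl'.le (le_a_shift hl hi) 2)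

/-- The dyadic decomposition of the `Ḣ^{1/2}` energy: `Σ_j 2^j ‖Δ_j w‖₂² ≤ 2 ∫ |ξ| |𝓕w|²`
(Littlewood–Paley, BCD 2011 §2). [cite: Ri2025, l.333–334 (`Ḣ^{1/2} ↪ X₁`); proof of Lemma 2.1 (i) (4.4)] -/
private theorem tsum_dyadic_le {w : E3 → C3} (hw : MemLp w 2 (volume : Measure E3)) :
    ∑' j : ℤ, ENNReal.ofReal ((2 : ℝ) ^ j) * dyadicSq w j ≤
      2 * ∫⁻ ξ, ‖ξ‖ₑ ^ (2 * (1 / 2 : ℝ)) *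
        ‖(𝓕 (hw.toLp w) : Lp C3 2 (volume : Measure E3)) ξ‖ₑ ^ 2 := by
  set G : E3 → ℝ≥0∞ := fun ξ => ‖(𝓕 (hw.toLp w) : Lp C3 2 (volume : Measure E3)) ξ‖ₑ ^ 2 with hG
  have hGm : AEMeasurable G volume :=
    (Lp.aestronglyMeasurable _).aemeasurable.enorm.pow_const 2
  have h1 : ∀ j : ℤ, ENNReal.ofReal ((2 : ℝ) ^ j) * dyadicSq w j =
      ∫⁻ ξ, (shell j).indicator (fun ξ => ENNReal.ofReal ((2 : ℝ) ^ j) * G ξ) ξ := by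
    intro j
    rw [dyadicSq_eq, fourierEnergyOn, dif_pos hw, lintegral_indicator (measurableSet_shell j),
      ← lintegral_const_mul' _ _ ENNReal.ofReal_ne_top]
    refine setLIntegral_congr_fun (measurableSet_shell j) fun ξ _ => ?_
    simp only [hG, mul_zero, ENNReal.rpow_zero, one_mul]
  simp_rw [h1]
  rw [← lintegral_tsum fun j => (hGm.const_mul _).indicator (measurableSet_shell j)]
  have h2 : ∀ ξ : E3, ∑' j : ℤ, (shell j).indicator (fun ξ => ENNReal.ofReal ((2 : ℝ) ^ j) * G ξ) ξ
      ≤ 2 * (‖ξ‖ₑ ^ (2 * (1 / 2 : ℝ)) * G ξ) := by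
    intro ξ
    by_cases hξ : ∃ j : ℤ, ξ ∈ shell j
    · obtain ⟨j₀, hj₀⟩ := hξ
      rw [tsum_eq_single j₀ fun j hj => Set.indicator_of_notMem
        (fun hj' => hj (shell_unique hj' hj₀)) _, Set.indicator_of_mem hj₀]
      have hle : ENNReal.ofReal ((2 : ℝ) ^ j₀) ≤ 2 * ‖ξ‖ₑ ^ (2 * (1 / 2 : ℝ)) := by
        rw [show (2 : ℝ) * (1 / 2) = 1 by norm_num, ENNReal.rpow_one, ← ofReal_norm]
        have h : (2 : ℝ) ^ (j₀ - 1) ≤ ‖ξ‖ := hj₀.1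
        rw [zpow_sub_one₀ (by norm_num : (2 : ℝ) ≠ 0)] at h
        calc ENNReal.ofReal ((2 : ℝ) ^ j₀) ≤ ENNReal.ofReal (2 * ‖ξ‖) :=
              ENNReal.ofReal_le_ofReal (by linarith)
          _ = 2 * ENNReal.ofReal ‖ξ‖ := by
              rw [ENNReal.ofReal_mul (by norm_num), ENNReal.ofReal_ofNat]
      calc ENNReal.ofReal ((2 : ℝ) ^ j₀) * G ξ ≤ (2 * ‖ξ‖ₑ ^ (2 * (1 / 2 : ℝ))) * G ξ := by
            gcongr
        _ = 2 * (‖ξ‖ₑ ^ (2 * (1 / 2 : ℝ)) * G ξ) := mul_assoc _ _ _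
    · push Not at hξ
      rw [ENNReal.tsum_eq_zero.2 fun j => Set.indicator_of_notMem (hξ j) _]
      exact zero_le
  calc ∫⁻ ξ, ∑' j : ℤ, (shell j).indicator (fun ξ => ENNReal.ofReal ((2 : ℝ) ^ j) * G ξ) ξ
      ≤ ∫⁻ ξ, 2 * (‖ξ‖ₑ ^ (2 * (1 / 2 : ℝ)) * G ξ) := lintegral_mono h2
    _ = 2 * ∫⁻ ξ, ‖ξ‖ₑ ^ (2 * (1 / 2 : ℝ)) * G ξ :=
        lintegral_const_mul' _ _ (by norm_num)

/-- For `w ∈ Ḣ^{1/2} ∩ L²` the dyadic `Ḣ^{1/2}` sum is finite. [cite: Ri2025, l.333–334; proof of Lemma 2.1 (i) (4.4)] -/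
private theorem tsum_dyadic_ne_top {w : E3 → C3} (hw : MemHomSobolev (1 / 2 : ℝ) w) :
    ∑' j : ℤ, ENNReal.ofReal ((2 : ℝ) ^ j) * dyadicSq w j ≠ ∞ := by
  have hfin := hw.eHomSobolevSeminorm_lt_top
  rw [Function.eHomSobolevSeminorm_of_memLp hw.memLp, eHomSobolevSeminorm] at hfin
  have hI : ∫⁻ ξ, ‖ξ‖ₑ ^ (2 * (1 / 2 : ℝ)) *
      ‖(𝓕 (hw.memLp.toLp w) : Lp C3 2 (volume : Measure E3)) ξ‖ₑ ^ 2 < ∞ := by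
    by_contra h
    rw [not_lt, top_le_iff] at h
    rw [h, ENNReal.top_rpow_of_pos (by norm_num)] at hfin
    exact lt_irrefl _ hfin
  refine ne_top_of_le_ne_top ?_ (tsum_dyadic_le hw.memLp)
  exact ENNReal.mul_ne_top (by norm_num) hI.ne

/-- **Lemma 2.1 (i) holds** (l.336–352, proof l.361–484): for `v ∈ Ḣ^{1/2} ∩ L²` and `ε > 0`
there is `l₀` with `‖λv(λ·)‖_{X₁} ≤ ε` for all `λ = 2^{2^{2^l}}`, `l ≥ l₀`. Route (the paper's):
under `λ = 2^m` the dyadic blocks shift, `‖Δ_j v_λ‖₂² = λ⁻¹‖Δ_{j−m}v‖₂²`, so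
`‖v_λ‖²_{X₁} = Σ_i 2^i a(i+m)⁻² ‖Δ_i v‖₂²`; with `m = 2^{2^l}` the weights `a(i+m) = log₂(i+m) ≥ l`
on `|i| ≤ l` ((2.2)), and `a ≥ 1` elsewhere; split the (finite, `v ∈ Ḣ^{1/2}`) sum
`Σ_i 2^i‖Δ_i v‖₂²` into a finite head (killed by `l⁻²`) and a small tail.
[cite: Ri2025, Lemma 2.1 (i) l.336–352, proof l.361–484 (print pp.5–7)] -/
theorem step_L21i_holds : Step_L21i := by
  intro v hv ε hε
  have hw : MemLp (cplx v) 2 (volume : Measure E3) := hv.memLp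
  set t : ℤ → ℝ≥0∞ := fun i => ENNReal.ofReal ((2 : ℝ) ^ i) * dyadicSq (cplx v) i with ht
  have hS : ∑' i, t i ≠ ∞ := tsum_dyadic_ne_top hv
  have hδ : (0 : ℝ≥0∞) < ENNReal.ofReal (ε ^ 2 / 2) := ENNReal.ofReal_pos.2 (by positivity)
  -- a finite set of dyadic indices outside which the `Ḣ^{1/2}`-sum is small
  obtain ⟨s₀, hs₀⟩ : ∃ s₀ : Finset ℤ, ∑' i : {x // x ∉ s₀}, t i ≤ ENNReal.ofReal (ε ^ 2 / 2) := by
    have h := ENNReal.tendsto_tsum_compl_atTop_zero hS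
    rw [ENNReal.tendsto_atTop_zero] at h
    obtain ⟨s₀, hs₀⟩ := h (ENNReal.ofReal (ε ^ 2 / 2)) hδ
    exact ⟨s₀, hs₀ s₀ le_rfl⟩
  -- the threshold `l₀`: at least `1`, at least `|i|` for `i ∈ s₀`, and `S / l₀² ≤ ε² / 2`
  set L₁ : ℕ := s₀.sup fun i => (|i|).toNat with hL₁
  have hL₁le : ∀ i ∈ s₀, |i| ≤ (L₁ : ℤ) := by
    intro i hi
    have h1 : (|i|).toNat ≤ L₁ := Finset.le_sup (f := fun i => (|i|).toNat) hi
    have h2 : ((|i|).toNat : ℤ) = |i| := Int.toNat_of_nonneg (abs_nonneg i)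
    omega
  set Sr : ℝ := (∑' i, t i).toReal with hSr
  have hSr0 : 0 ≤ Sr := ENNReal.toReal_nonneg
  set N : ℕ := ⌈2 * Sr / ε ^ 2⌉₊ + 1 with hN
  refine ⟨max (max L₁ 1) N, fun l hl => ?_⟩
  have hl1 : 1 ≤ l := le_trans (le_trans (le_max_right _ _) (le_max_left _ _)) hl
  have hlL : L₁ ≤ l := le_trans (le_trans (le_max_left _ _) (le_max_left _ _)) hl
  have hlN : N ≤ l := le_trans (le_max_right _ _) hl
  -- the `X₁` norm of the rescaled field is the shifted sum; it suffices to bound it by `ε²`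
  rw [cplx_nsRescaleData, eX1Norm_eq, X1Sq_rescale hw (2 ^ (2 ^ l))]
  have hε2 : ENNReal.ofReal ε = ENNReal.ofReal (ε ^ 2) ^ (1 / 2 : ℝ) := by
    rw [ENNReal.ofReal_rpow_of_nonneg (by positivity) (by norm_num), ← Real.sqrt_eq_rpow,
      Real.sqrt_sq hε.le]
  rw [hε2]
  refine ENNReal.rpow_le_rpow ?_ (by norm_num)
  set F : ℤ → ℝ≥0∞ := fun i =>
    ENNReal.ofReal ((2 : ℝ) ^ i / a (i + ((2 ^ (2 ^ l) : ℕ) : ℤ)) ^ 2) * dyadicSq (cplx v) i with hF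
  -- split into head (`i ∈ s₀`) and tail
  rw [← ENNReal.sum_add_tsum_compl s₀ F, show ENNReal.ofReal (ε ^ 2) =
    ENNReal.ofReal (ε ^ 2 / 2) + ENNReal.ofReal (ε ^ 2 / 2) by
      rw [← ENNReal.ofReal_add (by positivity) (by positivity), add_halves]]
  refine add_le_add ?_ ?_
  · -- head: each weight is `≤ 2^i / l²`, `Σ_{s₀} 2^i‖Δ_i v‖² ≤ S` and `S / l² ≤ ε² / 2`
    have hwin : ∀ i ∈ s₀, |i| ≤ (l : ℤ) := fun i hi => (hL₁le i hi).trans (by exact_mod_cast hlL)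
    calc ∑ i ∈ s₀, F i ≤ ∑ i ∈ s₀, ENNReal.ofReal (((l : ℝ) ^ 2)⁻¹) * t i := by
          refine Finset.sum_le_sum fun i hi => ?_
          simp only [hF, ht]
          rw [← mul_assoc]
          gcongr
          exact coeff_le_window hl1 (hwin i hi)
      _ = ENNReal.ofReal (((l : ℝ) ^ 2)⁻¹) * ∑ i ∈ s₀, t i := (Finset.mul_sum _ _ _).symm
      _ ≤ ENNReal.ofReal (((l : ℝ) ^ 2)⁻¹) * ∑' i, t i := by
          gcongr
          exact ENNReal.sum_le_tsum s₀
      _ = ENNReal.ofReal (((l : ℝ) ^ 2)⁻¹ * Sr) := by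
          rw [hSr, ENNReal.ofReal_mul (by positivity), ENNReal.ofReal_toReal hS]
      _ ≤ ENNReal.ofReal (ε ^ 2 / 2) := by
          apply ENNReal.ofReal_le_ofReal
          have hl1' : (1 : ℝ) ≤ l := by exact_mod_cast hl1
          have hlN' : (N : ℝ) ≤ l := by exact_mod_cast hlN
          have hceil : 2 * Sr / ε ^ 2 ≤ (⌈2 * Sr / ε ^ 2⌉₊ : ℝ) := Nat.le_ceil _
          have hN' : (N : ℝ) = (⌈2 * Sr / ε ^ 2⌉₊ : ℝ) + 1 := by rw [hN]; push_cast; ring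
          have hl2 : 2 * Sr / ε ^ 2 ≤ (l : ℝ) ^ 2 := by
            have : (l : ℝ) ≤ (l : ℝ) ^ 2 := le_self_pow₀ hl1' two_ne_zero
            linarith
          rw [div_le_iff₀ (by positivity)] at hl2
          rw [inv_mul_le_iff₀ (by positivity)]
          linarith
  · -- tail: weights `≤ 2^i`, then the choice of `s₀`
    calc ∑' i : ↥((s₀ : Set ℤ)ᶜ), F i ≤ ∑' i : {x // x ∉ s₀}, t i := by
          refine ENNReal.tsum_le_tsum fun i => ?_
          simp only [hF, ht]
          gcongr
          exact div_le_self (by positivity) (one_le_pow₀ (one_le_a _))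
      _ ≤ ENNReal.ofReal (ε ^ 2 / 2) := hs₀

/-- `Step_L21i` — `_holds` alias of `step_L21i_holds` above under the fact's exact name (appended
2026-08-28, D-0026 bookkeeping: the proof term is the existing theorem of this file; no statement,
definition or attribute is edited; no new named fact; the ledger's debt table listed the fact
unproved). [cite: Ri2025, Lemma 2.1 (i) l.336–352, proof l.361–484 (print pp.5–7)] -/
theorem _root_.Literature.Claims.NS.Ri2025.Step_L21i_holds : Step_L21i :=
  _root_.Literature.Claims.NS.Ri2025.step_L21i_holds

end

end Literature.Claims.NS.Ri2025
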